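import Literature.NumberTheory.LFunctions.MontgomeryVaughanLogMeansPlancherel
import Literature.NumberTheory.LFunctions.MontgomeryVaughanLogMeansProofs
import Literature.NumberTheory.LFunctions.MontgomeryVaughanLogMeansLemma2Proofs
import Literature.NumberTheory.LFunctions.MontgomeryVaughanLogMeansT1
import Mathlib.Analysis.SpecialFunctions.ImproperIntegrals
import HarnessLib

/-!
# Montgomery–Vaughan 2001, toward Theorem 3: the box estimates (23)–(24) and `∫_0^{log x} |S₁(e^w)| dw`

Support file (everything PROVED, no definitions, no named facts) for the discharge of
`Literature.NumberTheory.LFunctions.MontgomeryVaughan2001_thm3` (H. L. Montgomery, R. C. Vaughan,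
*Mean values of multiplicative functions*, Period. Math. Hungar. 43 (2001), Theorem 3), following the
deduction "Theorem 2 ⇒ Theorem 3" of §3 of the paper as reproduced in Roy–Vatwani 2019, §§6.1, 7.2
(`k = 1`).  For `f : ℕ →*₀ ℂ` totally multiplicative with `|f| ≤ 1`, `F(s) = Σ f(n)n^{-s}`,
`1 < σ ≤ 2`, `δ = σ − 1`:

* the pointwise box estimates (Roy–Vatwani Lemma 7.3 at `k = 1`, the inner maximum over `σ'`
  dropped): on the window `|t − m| ≤ 1/2`, `0 < α ≤ 1`,
  `|F(1+α+it)|/|α+it| ≤ K_B |F(σ)| R(α) w_m`, `R(α) = δ/α² + δ^{1−4/π}/α + α^{1−4/π}/δ`,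
  `w_0 = 1`, `w_m = (1+log(3+|m|))^{4/π}/|m|` (`exists_window_majorant`), from Lemma 1
  (`MontgomeryVaughan2001_lemma1_holds`) and Lemma 2 (`MontgomeryVaughan2001_lemma2_holds`) of the
  tree;
* the mean square `J(α) = ∫ u²|S₁(e^u)|²e^{−2αu} du ≤ K_J² |F(σ)|² R(α)²/α`
  (`exists_meanSquare_le`): the Plancherel identity of `MontgomeryVaughanLogMeansPlancherel.lean`,
  the window mean square of `P = Σ f(n)Λ(n)n^{-s}` (`MontgomeryVaughanLogMeansWindow.lean`), and the
  decomposition of `∫_ℝ` into the windows;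
* `∫_0^{L} |S₁(e^w)| dw ≤ K |F(σ)| (δ L² + δ^{1−4/π} L + L^{4/π−1}/δ)` for `L ≥ 1`
  (`exists_integral_norm_S₁_le`): Cauchy–Schwarz on `[0, v]` (Roy–Vatwani (eq:T1 step1)) and a
  dyadic decomposition in place of the printed integration by parts.

## References
- [MontgomeryVaughan2001] H. L. Montgomery, R. C. Vaughan, *Mean values of multiplicative functions*,
  Period. Math. Hungar. 43 (2001), §3, (21)–(24) (not held; read through:)
- [RoyVatwani2019] A. Roy, A. Vatwani, *Zeros of partial sums of L-functions*, arXiv:1807.11093, §6.1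
  ((eq:T1step1general)–(eq:T1 goal)) and §7.2 (Lemma 7.3) (arXiv pp. 14–15, 17–18).
-/

noncomputable section

open Complex Real MeasureTheory Set Filter Finset

namespace Literature.NumberTheory.LFunctions.MontgomeryVaughan2001

open MellinPlancherel (psum)
open scoped ArithmeticFunction.vonMangoldt


/-! ### §1. Twists `f(n) n^{-it}` and the size of `F(σ)` -/

/-- The twist `f_s(n) = f(n) n^{-s}` has Dirichlet series `Σ f_s(n) n^{-z} = F(z + s)`. [folklore] -/
theorem LSeries_mul_summandHom_eq (f : ℕ →*₀ ℂ) {s : ℂ} (hs : s ≠ 0) (z : ℂ) :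
    LSeries ((f * riemannZetaSummandHom hs) ·) z = LSeries (f ·) (z + s) := by
  rw [LSeries, LSeries]
  refine tsum_congr fun n => ?_
  rcases Nat.eq_zero_or_pos n with rfl | hn
  · simp
  · have hn0 : (n : ℂ) ≠ 0 := by exact_mod_cast hn.ne'
    rw [LSeries.term_of_ne_zero hn.ne', LSeries.term_of_ne_zero hn.ne', mulHom_apply,
      Complex.cpow_add _ _ hn0]
    show f n * (n : ℂ) ^ (-s) / (n : ℂ) ^ z = f n / ((n : ℂ) ^ z * (n : ℂ) ^ s)
    rw [Complex.cpow_neg]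
    field_simp

/-- The imaginary twist `f(n) n^{-it}` is bounded by `1`. [folklore] -/
theorem norm_mul_summandHom_imag_le (f : ℕ →*₀ ℂ) (hf : ∀ n, ‖f n‖ ≤ 1) {t : ℝ}
    (ht : (t * I : ℂ) ≠ 0) (n : ℕ) : ‖(f * riemannZetaSummandHom ht) n‖ ≤ 1 := by
  refine (norm_mul_summandHom_le' f hf ht n).trans ?_
  simp

/-- **`|F(2)| ≥ e^{−4}`**: `|F(2)| = exp(Re Σ_p −log(1 − f(p)p^{-2}))` and the exponent is within
`Σ_p p^{-2} ≤ 2` of `Re Σ_p f(p)p^{-2}`, itself of modulus `≤ 2`. [folklore] -/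
theorem exp_neg_four_le_norm_LSeries_two (f : ℕ →*₀ ℂ) (hf : ∀ n, ‖f n‖ ≤ 1) :
    Real.exp (-4) ≤ ‖LSeries (f ·) (2 : ℝ)‖ := by
  have h2 : (1 : ℝ) < 2 := by norm_num
  have hne : ((2 : ℝ) : ℂ) ≠ 0 := by norm_num
  set g : ℕ →*₀ ℂ := f * riemannZetaSummandHom hne with hgdef
  have hg := norm_mul_summandHom_le f hf hne
  obtain ⟨-, hG, hE⟩ := eulerPackage h2 g hg
  rw [tsum_mul_summandHom_eq_LSeries] at hE
  have hA := abs_re_tsum_neg_log_sub_re_tsum_le h2 g hg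
  have hZ := tsum_primes_one_div_sq_le_two
  -- `|Re Σ_p g(p)| ≤ Σ_p 1/p² ≤ 2`
  have hB : |(∑' p : Nat.Primes, g p).re| ≤ 2 := by
    refine (abs_re_le_norm _).trans ((norm_tsum_le_tsum_norm hG.norm).trans ?_)
    refine (Summable.tsum_le_tsum (fun p => ?_) hG.norm summable_primes_one_div_sq).trans hZ
    refine (hg p).trans ?_
    have hp1 : (1 : ℝ) ≤ (p : ℕ) := by exact_mod_cast p.prop.one_lt.le
    rw [Real.rpow_neg (by linarith), one_div, Real.rpow_two]
  rw [← hE, Real.exp_le_exp]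
  have := abs_le.1 hA
  have := abs_le.1 hB
  linarith

/-- **`|F(σ)| ≫ σ − 1` on `(1, 2]`**: there is an absolute `c > 0` with `c(σ−1) ≤ |F(σ)|` (Lemma 1
between `σ` and `2`, and `|F(2)| ≥ e^{-4}`). [cite: MontgomeryVaughan2001, Lemma 1] -/
theorem exists_norm_LSeries_ge :
    ∃ c : ℝ, 0 < c ∧ ∀ f : ℕ →*₀ ℂ, (∀ n, ‖f n‖ ≤ 1) → ∀ σ : ℝ, 1 < σ → σ ≤ 2 →
      c * (σ - 1) ≤ ‖LSeries (f ·) σ‖ := by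
  obtain ⟨C, hC, hL⟩ := MontgomeryVaughan2001_lemma1_holds
  refine ⟨Real.exp (-4) / C, by positivity, fun f hf σ hσ hσ2 => ?_⟩
  have h := (hL f hf σ 2 hσ hσ2 le_rfl).2
  have h2 := exp_neg_four_le_norm_LSeries_two f hf
  -- `(σ−1) e^{-4} ≤ (σ−1)|F(2)| ≤ C |F(σ)|`
  have h3 : (σ - 1) * Real.exp (-4) ≤ C * ‖LSeries (f ·) σ‖ := by
    calc (σ - 1) * Real.exp (-4) ≤ (σ - 1) * ‖LSeries (f ·) (2 : ℝ)‖ :=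
          mul_le_mul_of_nonneg_left h2 (by linarith)
      _ ≤ C * (2 - 1) * ‖LSeries (f ·) σ‖ := h
      _ = C * ‖LSeries (f ·) σ‖ := by ring
  calc Real.exp (-4) / C * (σ - 1) = (σ - 1) * Real.exp (-4) / C := by ring
    _ ≤ C * ‖LSeries (f ·) σ‖ / C := div_le_div_of_nonneg_right h3 hC.le
    _ = ‖LSeries (f ·) σ‖ := by field_simp

/-! ### §2. The box estimates: `|F(1+α+it)|/|α+it|` in terms of `|F(σ)|` (Roy–Vatwani Lemma 7.3, `k = 1`) -/

/-- The exponent `4/π` lies in `(1, 4/3]`. [folklore] -/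
theorem four_div_pi_bounds : 1 < 4 / π ∧ 4 / π ≤ 4 / 3 := by
  constructor
  · rw [lt_div_iff₀ Real.pi_pos]; linarith [Real.pi_lt_four]
  · exact div_le_div_of_nonneg_left (by norm_num) (by norm_num) Real.pi_gt_three.le

/-- `x^{4/π} ≤ (3/2) x` for `0 ≤ x ≤ 3/2` (write `x^{4/π} = x · x^{4/π−1}`). [folklore] -/
theorem rpow_four_div_pi_le {x : ℝ} (hx0 : 0 ≤ x) (hx : x ≤ 3 / 2) : x ^ (4 / π) ≤ 3 / 2 * x := by
  obtain ⟨he1, he2⟩ := four_div_pi_bounds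
  rcases hx0.eq_or_lt with rfl | hpos
  · rw [Real.zero_rpow (by linarith)]; simp
  have h1 : x ^ (4 / π) = x ^ (4 / π - 1) * x := by
    rw [Real.rpow_sub_one hpos.ne']; field_simp
  rw [h1]
  refine mul_le_mul_of_nonneg_right ?_ hx0
  calc x ^ (4 / π - 1) ≤ (3 / 2 : ℝ) ^ (4 / π - 1) := Real.rpow_le_rpow hx0 hx (by linarith)
    _ ≤ (3 / 2 : ℝ) ^ (1 : ℝ) := Real.rpow_le_rpow_of_exponent_le (by norm_num) (by linarith)
    _ = 3 / 2 := Real.rpow_one _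

/-- `(a/b)^{4/π} = a^{4/π} b^{−4/π}` for `a, b ≥ 0`. [folklore] -/
theorem div_rpow_four_div_pi {a b : ℝ} (ha : 0 ≤ a) (hb : 0 ≤ b) :
    (a / b) ^ (4 / π) = a ^ (4 / π) * b ^ (-(4 / π)) := by
  rw [Real.div_rpow ha hb, Real.rpow_neg hb, div_eq_mul_inv]

/-- `b^{−4/π} · b = b^{1−4/π}` for `b > 0`. [folklore] -/
theorem rpow_neg_mul_self {b : ℝ} (hb : 0 < b) : b ^ (-(4 / π)) * b = b ^ (1 - 4 / π) := by
  rw [show (1 : ℝ) - 4 / π = -(4 / π) + 1 by ring, Real.rpow_add hb, Real.rpow_one]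

/-- `|α + it| ≥ α`, `≥ |t|`, and `> 0` (`α > 0`). [folklore] -/
theorem norm_add_mul_I_ge {α : ℝ} (hα : 0 < α) (t : ℝ) :
    α ≤ ‖(α : ℂ) + t * I‖ ∧ |t| ≤ ‖(α : ℂ) + t * I‖ ∧ 0 < ‖(α : ℂ) + t * I‖ := by
  have h1 : α ≤ ‖(α : ℂ) + t * I‖ := by
    have := Complex.abs_re_le_norm ((α : ℂ) + t * I)
    simp only [Complex.add_re, Complex.ofReal_re, Complex.mul_re, Complex.I_re, Complex.ofReal_im,
      Complex.I_im, mul_zero, mul_one, sub_self, add_zero] at this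
    rwa [abs_of_pos hα] at this
  have h2 : |t| ≤ ‖(α : ℂ) + t * I‖ := by
    have := Complex.abs_im_le_norm ((α : ℂ) + t * I)
    simpa using this
  exact ⟨h1, h2, hα.trans_le h1⟩

/-- **Lemma 1 on a vertical line** (applied to the twist `f(n)n^{-it}`): for `1 < σ₁ ≤ σ₂ ≤ 2` and
real `t`, `(σ₁−1)|F(σ₁+it)| ≤ C₁(σ₂−1)|F(σ₂+it)|`. [cite: MontgomeryVaughan2001, Lemma 1] -/
theorem lemma1_vertical {C₁ : ℝ}
    (hL1 : ∀ f : ℕ →*₀ ℂ, (∀ n, ‖f n‖ ≤ 1) → ∀ σ₁ σ₂ : ℝ, 1 < σ₁ → σ₁ ≤ σ₂ → σ₂ ≤ 2 →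
      (σ₁ - 1) * ‖LSeries (f ·) σ₁‖ ≤ C₁ * (σ₂ - 1) * ‖LSeries (f ·) σ₂‖ ∧
      (σ₁ - 1) * ‖LSeries (f ·) σ₂‖ ≤ C₁ * (σ₂ - 1) * ‖LSeries (f ·) σ₁‖)
    (f : ℕ →*₀ ℂ) (hf : ∀ n, ‖f n‖ ≤ 1) (t : ℝ) {σ₁ σ₂ : ℝ} (h1 : 1 < σ₁) (h12 : σ₁ ≤ σ₂)
    (h2 : σ₂ ≤ 2) :
    (σ₁ - 1) * ‖LSeries (f ·) (σ₁ + t * I)‖ ≤ C₁ * (σ₂ - 1) * ‖LSeries (f ·) (σ₂ + t * I)‖ := by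
  rcases eq_or_ne t 0 with rfl | ht
  · simpa using (hL1 f hf σ₁ σ₂ h1 h12 h2).1
  · have hs : (t * I : ℂ) ≠ 0 := mul_ne_zero (by exact_mod_cast ht) Complex.I_ne_zero
    have h := (hL1 (f * riemannZetaSummandHom hs) (norm_mul_summandHom_imag_le f hf hs) σ₁ σ₂ h1 h12 h2).1
    rwa [LSeries_mul_summandHom_eq, LSeries_mul_summandHom_eq] at h

/-- **Lemma 2 with a uniform junk factor for `|t| ≥ 1/2`**: for `1 < σ' ≤ 2`, `|t| ≥ 1/2`,
`|F(σ'+it)| ≤ 9 C₂ (1 + log(2+|t|))^{4/π} (σ'−1)^{−4/π} |F(σ')|` (both ranges of Lemma 2, using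
`1 + |t|/(σ'−1) ≤ 3/(σ'−1)` for `|t| ≤ 2` and `log|t| ≤ 1 + log(2+|t|)` for `|t| ≥ 2`, and
`3^{4/π} ≤ 9`). [cite: MontgomeryVaughan2001, Lemma 2] -/
theorem lemma2_junk {C₂ : ℝ} (hC₂ : 0 < C₂)
    (hL2 : ∀ f : ℕ →*₀ ℂ, (∀ n, ‖f n‖ ≤ 1) → ∀ σ t : ℝ, 1 < σ → σ ≤ 2 →
      (|t| ≤ 2 → ‖LSeries (f ·) (σ + t * I)‖ ≤
          C₂ * (1 + |t| / (σ - 1)) ^ (4 / Real.pi) * ‖LSeries (f ·) σ‖) ∧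
      (2 ≤ |t| → ‖LSeries (f ·) (σ + t * I)‖ ≤
          C₂ * (Real.log |t| / (σ - 1)) ^ (4 / Real.pi) * ‖LSeries (f ·) σ‖))
    (f : ℕ →*₀ ℂ) (hf : ∀ n, ‖f n‖ ≤ 1) {σ t : ℝ} (hσ : 1 < σ) (hσ2 : σ ≤ 2) (ht : 1 / 2 ≤ |t|) :
    ‖LSeries (f ·) (σ + t * I)‖ ≤
      9 * C₂ * (1 + Real.log (2 + |t|)) ^ (4 / π) * (σ - 1) ^ (-(4 / π)) * ‖LSeries (f ·) σ‖ := by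
  obtain ⟨he1, he2⟩ := four_div_pi_bounds
  have hδ : 0 < σ - 1 := by linarith
  have hδ1 : σ - 1 ≤ 1 := by linarith
  set Λt : ℝ := 1 + Real.log (2 + |t|) with hΛt
  have hlog0 : 0 ≤ Real.log (2 + |t|) := Real.log_nonneg (by linarith [abs_nonneg t])
  have hΛ1 : 1 ≤ Λt := by rw [hΛt]; linarith
  have hΛpow : 1 ≤ Λt ^ (4 / π) := Real.one_le_rpow hΛ1 (by linarith)
  have hδpow : 0 < (σ - 1) ^ (-(4 / π)) := Real.rpow_pos_of_pos hδ _
  have hF0 := norm_nonneg (LSeries (f ·) σ)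
  -- `3^{4/π} ≤ 9`
  have h3 : (3 : ℝ) ^ (4 / π) ≤ 9 := by
    calc (3 : ℝ) ^ (4 / π) ≤ (3 : ℝ) ^ (2 : ℝ) := Real.rpow_le_rpow_of_exponent_le (by norm_num) (by linarith)
      _ = 9 := by rw [Real.rpow_two]; norm_num
  obtain ⟨hA, hB⟩ := hL2 f hf σ t hσ hσ2
  rcases le_or_gt |t| 2 with h2 | h2
  · -- `|t| ≤ 2`: `1 + |t|/δ ≤ 3/δ`
    have h := hA h2
    have hbase : 1 + |t| / (σ - 1) ≤ 3 / (σ - 1) := by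
      have heq : 1 + |t| / (σ - 1) = ((σ - 1) + |t|) / (σ - 1) := by field_simp
      rw [heq, div_le_div_iff_of_pos_right hδ]; linarith
    have hpow : (1 + |t| / (σ - 1)) ^ (4 / π) ≤ 9 * (σ - 1) ^ (-(4 / π)) := by
      calc (1 + |t| / (σ - 1)) ^ (4 / π) ≤ (3 / (σ - 1)) ^ (4 / π) :=
            Real.rpow_le_rpow (by positivity) hbase (by linarith)
        _ = (3 : ℝ) ^ (4 / π) * (σ - 1) ^ (-(4 / π)) := div_rpow_four_div_pi (by norm_num) hδ.le
        _ ≤ 9 * (σ - 1) ^ (-(4 / π)) := mul_le_mul_of_nonneg_right h3 hδpow.le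
    calc ‖LSeries (f ·) (σ + t * I)‖ ≤ C₂ * (1 + |t| / (σ - 1)) ^ (4 / π) * ‖LSeries (f ·) σ‖ := h
      _ ≤ C₂ * (9 * (σ - 1) ^ (-(4 / π))) * ‖LSeries (f ·) σ‖ := by gcongr
      _ = 9 * C₂ * 1 * (σ - 1) ^ (-(4 / π)) * ‖LSeries (f ·) σ‖ := by ring
      _ ≤ 9 * C₂ * Λt ^ (4 / π) * (σ - 1) ^ (-(4 / π)) * ‖LSeries (f ·) σ‖ := by gcongr
  · -- `|t| ≥ 2`: `log|t| ≤ Λt`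
    have h := hB h2.le
    have hlogt0 : 0 ≤ Real.log |t| := Real.log_nonneg (by linarith)
    have hlogt : Real.log |t| ≤ Λt := by
      rw [hΛt]
      have := Real.log_le_log (by linarith) (by linarith : |t| ≤ 2 + |t|)
      linarith
    have hpow : (Real.log |t| / (σ - 1)) ^ (4 / π) ≤ 9 * Λt ^ (4 / π) * (σ - 1) ^ (-(4 / π)) := by
      calc (Real.log |t| / (σ - 1)) ^ (4 / π) ≤ (Λt / (σ - 1)) ^ (4 / π) :=
            Real.rpow_le_rpow (by positivity) (div_le_div_of_nonneg_right hlogt hδ.le) (by linarith)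
        _ = Λt ^ (4 / π) * (σ - 1) ^ (-(4 / π)) := div_rpow_four_div_pi (by linarith) hδ.le
        _ = 1 * (Λt ^ (4 / π) * (σ - 1) ^ (-(4 / π))) := by ring
        _ ≤ 9 * (Λt ^ (4 / π) * (σ - 1) ^ (-(4 / π))) := by gcongr; norm_num
        _ = 9 * Λt ^ (4 / π) * (σ - 1) ^ (-(4 / π)) := by ring
    calc ‖LSeries (f ·) (σ + t * I)‖ ≤ C₂ * (Real.log |t| / (σ - 1)) ^ (4 / π) * ‖LSeries (f ·) σ‖ := h
      _ ≤ C₂ * (9 * Λt ^ (4 / π) * (σ - 1) ^ (-(4 / π))) * ‖LSeries (f ·) σ‖ := by gcongr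
      _ = 9 * C₂ * Λt ^ (4 / π) * (σ - 1) ^ (-(4 / π)) * ‖LSeries (f ·) σ‖ := by ring

/-- **The box estimate at the window `m = 0`** (Roy–Vatwani (bound-t small), `k = 1`): for
`|t| ≤ 1/2`, `0 < α ≤ 1`, `1 < σ ≤ 2`, `δ = σ − 1`,
`|F(1+α+it)|/|α+it| ≤ 4C₁C₂ |F(σ)| (δ/α² + δ^{1−4/π}/α + α^{1−4/π}/δ)`.
[cite: RoyVatwani2019, Lemma 7.3 (bound-t small)] -/
theorem window_majorant_zero {C₁ C₂ : ℝ} (hC₁ : 0 < C₁) (hC₂ : 0 < C₂)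
    (hL1 : ∀ f : ℕ →*₀ ℂ, (∀ n, ‖f n‖ ≤ 1) → ∀ σ₁ σ₂ : ℝ, 1 < σ₁ → σ₁ ≤ σ₂ → σ₂ ≤ 2 →
      (σ₁ - 1) * ‖LSeries (f ·) σ₁‖ ≤ C₁ * (σ₂ - 1) * ‖LSeries (f ·) σ₂‖ ∧
      (σ₁ - 1) * ‖LSeries (f ·) σ₂‖ ≤ C₁ * (σ₂ - 1) * ‖LSeries (f ·) σ₁‖)
    (hL2 : ∀ f : ℕ →*₀ ℂ, (∀ n, ‖f n‖ ≤ 1) → ∀ σ t : ℝ, 1 < σ → σ ≤ 2 →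
      (|t| ≤ 2 → ‖LSeries (f ·) (σ + t * I)‖ ≤
          C₂ * (1 + |t| / (σ - 1)) ^ (4 / Real.pi) * ‖LSeries (f ·) σ‖) ∧
      (2 ≤ |t| → ‖LSeries (f ·) (σ + t * I)‖ ≤
          C₂ * (Real.log |t| / (σ - 1)) ^ (4 / Real.pi) * ‖LSeries (f ·) σ‖))
    (f : ℕ →*₀ ℂ) (hf : ∀ n, ‖f n‖ ≤ 1) {σ : ℝ} (hσ : 1 < σ) (hσ2 : σ ≤ 2) {α : ℝ} (hα : 0 < α)
    (hα1 : α ≤ 1) {t : ℝ} (ht : |t| ≤ 1 / 2) :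
    ‖LSeries (f ·) (((1 + α : ℝ) : ℂ) + t * I)‖ / ‖(α : ℂ) + t * I‖ ≤
      4 * C₁ * C₂ * ‖LSeries (f ·) σ‖ *
        ((σ - 1) / α ^ 2 + (σ - 1) ^ (1 - 4 / π) / α + α ^ (1 - 4 / π) / (σ - 1)) := by
  obtain ⟨he1, he2⟩ := four_div_pi_bounds
  have hδ : 0 < σ - 1 := by linarith
  have hδ1 : σ - 1 ≤ 1 := by linarith
  have hα' : 1 < 1 + α := by linarith
  have hα2 : 1 + α ≤ 2 := by linarith
  obtain ⟨hDα, hDt, hD0⟩ := norm_add_mul_I_ge hα t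
  set D : ℝ := ‖(α : ℂ) + t * I‖ with hD
  set Fσ : ℝ := ‖LSeries (f ·) σ‖ with hFσ
  have hF0 : 0 ≤ Fσ := norm_nonneg _
  set N : ℝ := ‖LSeries (f ·) (((1 + α : ℝ) : ℂ) + t * I)‖ with hN
  have ht2 : |t| ≤ 2 := by linarith
  -- the three terms of `R`
  have hR1 : 0 ≤ (σ - 1) / α ^ 2 := by positivity
  have hR2 : 0 ≤ (σ - 1) ^ (1 - 4 / π) / α := by positivity
  have hR3 : 0 ≤ α ^ (1 - 4 / π) / (σ - 1) := by positivity
  set R : ℝ := (σ - 1) / α ^ 2 + (σ - 1) ^ (1 - 4 / π) / α + α ^ (1 - 4 / π) / (σ - 1) with hR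
  rw [div_le_iff₀ hD0]
  rcases le_or_gt (σ - 1) α with hcase | hcase
  · -- Case `σ ≤ 1 + α`: Lemma 2 at `1 + α`, then Lemma 1 between `σ` and `1 + α`
    have h2 := (hL2 f hf (1 + α) t hα' hα2).1 ht2
    rw [show (1 + α : ℝ) - 1 = α by ring] at h2
    have h1 := (hL1 f hf σ (1 + α) hσ (by linarith) hα2).2
    rw [show (1 + α : ℝ) - 1 = α by ring] at h1
    -- `(1 + |t|/α)^{4/π} ≤ 3 D α^{-4/π}`
    have hsum : α + |t| ≤ 3 / 2 := by linarith
    have hsumD : α + |t| ≤ 2 * D := by linarith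
    have hpow : (1 + |t| / α) ^ (4 / π) ≤ 3 * D * α ^ (-(4 / π)) := by
      rw [show 1 + |t| / α = (α + |t|) / α by field_simp, div_rpow_four_div_pi (by positivity) hα.le]
      refine mul_le_mul_of_nonneg_right ?_ (Real.rpow_nonneg hα.le _)
      calc (α + |t|) ^ (4 / π) ≤ 3 / 2 * (α + |t|) := rpow_four_div_pi_le (by positivity) hsum
        _ ≤ 3 / 2 * (2 * D) := by gcongr
        _ = 3 * D := by ring
    -- `‖F(1+α)‖ ≤ C₁ (α/δ) Fσ`
    have hF1 : ‖LSeries (f ·) ((1 + α : ℝ) : ℂ)‖ ≤ C₁ * α / (σ - 1) * Fσ := by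
      rw [div_mul_eq_mul_div, le_div_iff₀ hδ]; linarith
    calc N ≤ C₂ * (1 + |t| / α) ^ (4 / π) * ‖LSeries (f ·) ((1 + α : ℝ) : ℂ)‖ := h2
      _ ≤ C₂ * (3 * D * α ^ (-(4 / π))) * (C₁ * α / (σ - 1) * Fσ) := by gcongr
      _ = 3 * C₁ * C₂ * Fσ * (α ^ (-(4 / π)) * α / (σ - 1)) * D := by ring
      _ = 3 * C₁ * C₂ * Fσ * (α ^ (1 - 4 / π) / (σ - 1)) * D := by rw [rpow_neg_mul_self hα]
      _ ≤ 4 * C₁ * C₂ * Fσ * R * D := by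
          gcongr
          · linarith
          · rw [hR]; linarith
  · -- Case `1 + α < σ`: Lemma 1 (vertical) between `1 + α` and `σ`, then Lemma 2 at `σ`
    have h1 := lemma1_vertical hL1 f hf t hα' (by linarith : 1 + α ≤ σ) hσ2
    rw [show (1 + α : ℝ) - 1 = α by ring] at h1
    have h2 := (hL2 f hf σ t hσ hσ2).1 ht2
    -- `N ≤ C₁ (δ/α) ‖F(σ+it)‖`
    have hN1 : N ≤ C₁ * (σ - 1) / α * ‖LSeries (f ·) (σ + t * I)‖ := by
      rw [div_mul_eq_mul_div, le_div_iff₀ hα]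
      have : N * α = α * N := mul_comm _ _
      rw [this]
      convert h1 using 2
    rcases le_or_gt |t| (σ - 1) with hsub | hsub
    · -- `|t| ≤ δ`: `(1+|t|/δ)^{4/π} ≤ 4`
      have hpow : (1 + |t| / (σ - 1)) ^ (4 / π) ≤ 4 := by
        have hb : 1 + |t| / (σ - 1) ≤ 2 := by
          have : |t| / (σ - 1) ≤ 1 := (div_le_one hδ).2 hsub
          linarith
        calc (1 + |t| / (σ - 1)) ^ (4 / π) ≤ (2 : ℝ) ^ (4 / π) := Real.rpow_le_rpow (by positivity) hb (by linarith)
          _ ≤ (2 : ℝ) ^ (2 : ℝ) := Real.rpow_le_rpow_of_exponent_le (by norm_num) (by linarith)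
          _ = 4 := by rw [Real.rpow_two]; norm_num
      calc N ≤ C₁ * (σ - 1) / α * ‖LSeries (f ·) (σ + t * I)‖ := hN1
        _ ≤ C₁ * (σ - 1) / α * (C₂ * (1 + |t| / (σ - 1)) ^ (4 / π) * Fσ) := by gcongr
        _ ≤ C₁ * (σ - 1) / α * (C₂ * 4 * Fσ) := by gcongr
        _ = 4 * C₁ * C₂ * Fσ * ((σ - 1) / α ^ 2) * α := by field_simp
        _ ≤ 4 * C₁ * C₂ * Fσ * R * D := by
            gcongr
            rw [hR]; linarith
    · -- `δ < |t| ≤ 1/2`: `(1+|t|/δ)^{4/π} ≤ 4 D δ^{-4/π}`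
      have hpow : (1 + |t| / (σ - 1)) ^ (4 / π) ≤ 3 * D * (σ - 1) ^ (-(4 / π)) := by
        rw [show 1 + |t| / (σ - 1) = ((σ - 1) + |t|) / (σ - 1) by field_simp,
          div_rpow_four_div_pi (by positivity) hδ.le]
        refine mul_le_mul_of_nonneg_right ?_ (Real.rpow_nonneg hδ.le _)
        have hsum : (σ - 1) + |t| ≤ 3 / 2 := by linarith
        calc ((σ - 1) + |t|) ^ (4 / π) ≤ 3 / 2 * ((σ - 1) + |t|) := rpow_four_div_pi_le (by positivity) hsum
          _ ≤ 3 / 2 * (2 * D) := by gcongr; linarith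
          _ = 3 * D := by ring
      calc N ≤ C₁ * (σ - 1) / α * ‖LSeries (f ·) (σ + t * I)‖ := hN1
        _ ≤ C₁ * (σ - 1) / α * (C₂ * (1 + |t| / (σ - 1)) ^ (4 / π) * Fσ) := by gcongr
        _ ≤ C₁ * (σ - 1) / α * (C₂ * (3 * D * (σ - 1) ^ (-(4 / π))) * Fσ) := by gcongr
        _ = 3 * C₁ * C₂ * Fσ * ((σ - 1) ^ (-(4 / π)) * (σ - 1) / α) * D := by field_simp
        _ = 3 * C₁ * C₂ * Fσ * ((σ - 1) ^ (1 - 4 / π) / α) * D := by rw [rpow_neg_mul_self hδ]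
        _ ≤ 4 * C₁ * C₂ * Fσ * R * D := by
            gcongr
            · linarith
            · rw [hR]; linarith

/-- **The box estimate at the windows `m ≠ 0`** (Roy–Vatwani (bound-t big), `k = 1`): for
`|t − m| ≤ 1/2`, `m ∈ ℤ ∖ {0}`, `0 < α ≤ 1`, `1 < σ ≤ 2`,
`|F(1+α+it)|/|α+it| ≤ 36 C₁C₂ |F(σ)| (δ/α² + δ^{1−4/π}/α + α^{1−4/π}/δ) (1+log(3+|m|))^{4/π}/|m|`.
[cite: RoyVatwani2019, Lemma 7.3 (bound-t big)] -/
theorem window_majorant_ne_zero {C₁ C₂ : ℝ} (hC₁ : 0 < C₁) (hC₂ : 0 < C₂)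
    (hL1 : ∀ f : ℕ →*₀ ℂ, (∀ n, ‖f n‖ ≤ 1) → ∀ σ₁ σ₂ : ℝ, 1 < σ₁ → σ₁ ≤ σ₂ → σ₂ ≤ 2 →
      (σ₁ - 1) * ‖LSeries (f ·) σ₁‖ ≤ C₁ * (σ₂ - 1) * ‖LSeries (f ·) σ₂‖ ∧
      (σ₁ - 1) * ‖LSeries (f ·) σ₂‖ ≤ C₁ * (σ₂ - 1) * ‖LSeries (f ·) σ₁‖)
    (hL2 : ∀ f : ℕ →*₀ ℂ, (∀ n, ‖f n‖ ≤ 1) → ∀ σ t : ℝ, 1 < σ → σ ≤ 2 →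
      (|t| ≤ 2 → ‖LSeries (f ·) (σ + t * I)‖ ≤
          C₂ * (1 + |t| / (σ - 1)) ^ (4 / Real.pi) * ‖LSeries (f ·) σ‖) ∧
      (2 ≤ |t| → ‖LSeries (f ·) (σ + t * I)‖ ≤
          C₂ * (Real.log |t| / (σ - 1)) ^ (4 / Real.pi) * ‖LSeries (f ·) σ‖))
    (f : ℕ →*₀ ℂ) (hf : ∀ n, ‖f n‖ ≤ 1) {σ : ℝ} (hσ : 1 < σ) (hσ2 : σ ≤ 2) {α : ℝ} (hα : 0 < α)
    (hα1 : α ≤ 1) {m : ℤ} (hm : m ≠ 0) {t : ℝ} (ht : |t - m| ≤ 1 / 2) :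
    ‖LSeries (f ·) (((1 + α : ℝ) : ℂ) + t * I)‖ / ‖(α : ℂ) + t * I‖ ≤
      36 * C₁ * C₂ * ‖LSeries (f ·) σ‖ *
        ((σ - 1) / α ^ 2 + (σ - 1) ^ (1 - 4 / π) / α + α ^ (1 - 4 / π) / (σ - 1)) *
        ((1 + Real.log (3 + |(m : ℝ)|)) ^ (4 / π) / |(m : ℝ)|) := by
  obtain ⟨he1, he2⟩ := four_div_pi_bounds
  have hδ : 0 < σ - 1 := by linarith
  have hδ1 : σ - 1 ≤ 1 := by linarith
  have hα' : 1 < 1 + α := by linarith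
  have hα2 : 1 + α ≤ 2 := by linarith
  obtain ⟨hDα, hDt, hD0⟩ := norm_add_mul_I_ge hα t
  set D : ℝ := ‖(α : ℂ) + t * I‖ with hD
  set Fσ : ℝ := ‖LSeries (f ·) σ‖ with hFσ
  have hF0 : 0 ≤ Fσ := norm_nonneg _
  set N : ℝ := ‖LSeries (f ·) (((1 + α : ℝ) : ℂ) + t * I)‖ with hN
  -- `|m| ≥ 1`, `|t| ≥ |m| − 1/2 ≥ |m|/2 ≥ 1/2`, `|t| ≤ |m| + 1/2`
  have hm1 : (1 : ℝ) ≤ |(m : ℝ)| := by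
    rw [← Int.cast_abs]; exact_mod_cast Int.one_le_abs hm
  have hm0 : (0 : ℝ) < |(m : ℝ)| := by linarith
  have htm : |(m : ℝ)| - 1 / 2 ≤ |t| := by
    have := abs_sub_abs_le_abs_sub (m : ℝ) t
    rw [abs_sub_comm] at this
    linarith
  have htm' : |t| ≤ |(m : ℝ)| + 1 / 2 := by
    have := abs_sub_abs_le_abs_sub t (m : ℝ)
    linarith
  have ht12 : 1 / 2 ≤ |t| := by linarith
  have hDm : |(m : ℝ)| / 2 ≤ D := by linarith
  -- the junk factor `Λt^{4/π} ≤ Λm^{4/π}`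
  set Λm : ℝ := 1 + Real.log (3 + |(m : ℝ)|) with hΛm
  have hΛt : (1 + Real.log (2 + |t|)) ^ (4 / π) ≤ Λm ^ (4 / π) := by
    refine Real.rpow_le_rpow ?_ ?_ (by linarith)
    · have := Real.log_nonneg (by linarith [abs_nonneg t] : (1 : ℝ) ≤ 2 + |t|); linarith
    · rw [hΛm]
      have := Real.log_le_log (by linarith [abs_nonneg t]) (by linarith : 2 + |t| ≤ 3 + |(m : ℝ)|)
      linarith
  have hΛm0 : 0 ≤ Λm ^ (4 / π) := Real.rpow_nonneg (by
    rw [hΛm]; have := Real.log_nonneg (by linarith : (1 : ℝ) ≤ 3 + |(m : ℝ)|); linarith) _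
  set R : ℝ := (σ - 1) / α ^ 2 + (σ - 1) ^ (1 - 4 / π) / α + α ^ (1 - 4 / π) / (σ - 1) with hR
  have hR1 : 0 ≤ (σ - 1) / α ^ 2 := by positivity
  have hR2 : 0 ≤ (σ - 1) ^ (1 - 4 / π) / α := by positivity
  have hR3 : 0 ≤ α ^ (1 - 4 / π) / (σ - 1) := by positivity
  rw [div_le_iff₀ hD0]
  -- it suffices to bound `N ≤ 18 C₁C₂ Fσ R Λm^{4/π}` (then divide by `D ≥ |m|/2`)
  suffices hkey : N ≤ 18 * C₁ * C₂ * Fσ * R * Λm ^ (4 / π) by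
    calc N ≤ 18 * C₁ * C₂ * Fσ * R * Λm ^ (4 / π) := hkey
      _ = 36 * C₁ * C₂ * Fσ * R * (Λm ^ (4 / π) / |(m : ℝ)|) * (|(m : ℝ)| / 2) := by field_simp; ring
      _ ≤ 36 * C₁ * C₂ * Fσ * R * (Λm ^ (4 / π) / |(m : ℝ)|) * D := by gcongr
  rcases le_or_gt (σ - 1) α with hcase | hcase
  · -- `σ ≤ 1 + α`: Lemma 2 (junk) at `1 + α`, Lemma 1 between `σ` and `1 + α`
    have h2 := lemma2_junk hC₂ hL2 f hf hα' hα2 ht12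
    rw [show (1 + α : ℝ) - 1 = α by ring] at h2
    have h1 := (hL1 f hf σ (1 + α) hσ (by linarith) hα2).2
    rw [show (1 + α : ℝ) - 1 = α by ring] at h1
    have hF1 : ‖LSeries (f ·) ((1 + α : ℝ) : ℂ)‖ ≤ C₁ * α / (σ - 1) * Fσ := by
      rw [div_mul_eq_mul_div, le_div_iff₀ hδ]; linarith
    calc N ≤ 9 * C₂ * (1 + Real.log (2 + |t|)) ^ (4 / π) * α ^ (-(4 / π)) * ‖LSeries (f ·) ((1 + α : ℝ) : ℂ)‖ := h2
      _ ≤ 9 * C₂ * Λm ^ (4 / π) * α ^ (-(4 / π)) * (C₁ * α / (σ - 1) * Fσ) := by gcongr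
      _ = 9 * C₁ * C₂ * Fσ * (α ^ (-(4 / π)) * α / (σ - 1)) * Λm ^ (4 / π) := by ring
      _ = 9 * C₁ * C₂ * Fσ * (α ^ (1 - 4 / π) / (σ - 1)) * Λm ^ (4 / π) := by rw [rpow_neg_mul_self hα]
      _ ≤ 18 * C₁ * C₂ * Fσ * R * Λm ^ (4 / π) := by
          gcongr
          · linarith
          · rw [hR]; linarith
  · -- `1 + α < σ`: Lemma 1 (vertical), then Lemma 2 (junk) at `σ`
    have h1 := lemma1_vertical hL1 f hf t hα' (by linarith : 1 + α ≤ σ) hσ2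
    rw [show (1 + α : ℝ) - 1 = α by ring] at h1
    have h2 := lemma2_junk hC₂ hL2 f hf hσ hσ2 ht12
    have hN1 : N ≤ C₁ * (σ - 1) / α * ‖LSeries (f ·) (σ + t * I)‖ := by
      rw [div_mul_eq_mul_div, le_div_iff₀ hα]
      have : N * α = α * N := mul_comm _ _
      rw [this]
      convert h1 using 2
    calc N ≤ C₁ * (σ - 1) / α * ‖LSeries (f ·) (σ + t * I)‖ := hN1
      _ ≤ C₁ * (σ - 1) / α *
          (9 * C₂ * (1 + Real.log (2 + |t|)) ^ (4 / π) * (σ - 1) ^ (-(4 / π)) * Fσ) := by gcongr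
      _ ≤ C₁ * (σ - 1) / α * (9 * C₂ * Λm ^ (4 / π) * (σ - 1) ^ (-(4 / π)) * Fσ) := by gcongr
      _ = 9 * C₁ * C₂ * Fσ * ((σ - 1) ^ (-(4 / π)) * (σ - 1) / α) * Λm ^ (4 / π) := by field_simp
      _ = 9 * C₁ * C₂ * Fσ * ((σ - 1) ^ (1 - 4 / π) / α) * Λm ^ (4 / π) := by rw [rpow_neg_mul_self hδ]
      _ ≤ 18 * C₁ * C₂ * Fσ * R * Λm ^ (4 / π) := by
          gcongr
          · linarith
          · rw [hR]; linarith

/-! ### §3. Summability of the window weights -/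

/-- `(1 + log(3+n))^{8/π} ≤ 686 n^{−3/2} · n²`, i.e. the window weight at `n ≥ 1` satisfies
`((1+log(3+n))^{4/π}/n)² ≤ 686 n^{−3/2}`. [folklore] -/
theorem window_weight_sq_le {n : ℕ} (hn : 1 ≤ n) :
    ((1 + Real.log (3 + (n : ℝ))) ^ (4 / π) / (n : ℝ)) ^ 2 ≤ 686 * (n : ℝ) ^ (-(3 / 2 : ℝ)) := by
  obtain ⟨he1, he2⟩ := four_div_pi_bounds
  have hn0 : (0 : ℝ) < n := by exact_mod_cast hn
  have hn1 : (1 : ℝ) ≤ n := by exact_mod_cast hn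
  set y : ℝ := 3 + (n : ℝ) with hy
  have hy1 : 1 ≤ y := by rw [hy]; linarith
  have hy0 : 0 < y := by linarith
  have hlog0 : 0 ≤ Real.log y := Real.log_nonneg hy1
  set Lg : ℝ := 1 + Real.log y with hLg
  have hLg1 : 1 ≤ Lg := by rw [hLg]; linarith
  -- `Lg ≤ 7 y^{1/6}`
  have hy6 : 1 ≤ y ^ (1 / 6 : ℝ) := Real.one_le_rpow hy1 (by norm_num)
  have hLgle : Lg ≤ 7 * y ^ (1 / 6 : ℝ) := by
    have := Real.log_le_rpow_div hy0.le (by norm_num : (0 : ℝ) < 1 / 6)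
    rw [hLg]; linarith
  -- `Lg^{4/π} ≤ Lg^{3/2}` and its square `≤ Lg³ ≤ 343 y^{1/2}`
  have hpow : Lg ^ (4 / π) ≤ Lg ^ (3 / 2 : ℝ) := Real.rpow_le_rpow_of_exponent_le hLg1 (by linarith)
  have hsq : (Lg ^ (4 / π)) ^ 2 ≤ 343 * y ^ (1 / 2 : ℝ) := by
    calc (Lg ^ (4 / π)) ^ 2 ≤ (Lg ^ (3 / 2 : ℝ)) ^ 2 := by
          gcongr
      _ = Lg ^ (3 : ℝ) := by rw [← Real.rpow_natCast, ← Real.rpow_mul (by linarith)]; norm_num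
      _ ≤ (7 * y ^ (1 / 6 : ℝ)) ^ (3 : ℝ) := Real.rpow_le_rpow (by linarith) hLgle (by norm_num)
      _ = 343 * y ^ (1 / 2 : ℝ) := by
          rw [Real.mul_rpow (by norm_num) (by positivity), ← Real.rpow_mul hy0.le]
          norm_num
  -- `y^{1/2} ≤ 2 n^{1/2}` (as `y ≤ 4n`)
  have hyn : y ^ (1 / 2 : ℝ) ≤ 2 * (n : ℝ) ^ (1 / 2 : ℝ) := by
    have h4 : y ≤ 4 * n := by rw [hy]; linarith
    calc y ^ (1 / 2 : ℝ) ≤ (4 * (n : ℝ)) ^ (1 / 2 : ℝ) := Real.rpow_le_rpow hy0.le h4 (by norm_num)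
      _ = (4 : ℝ) ^ (1 / 2 : ℝ) * (n : ℝ) ^ (1 / 2 : ℝ) := Real.mul_rpow (by norm_num) hn0.le
      _ = 2 * (n : ℝ) ^ (1 / 2 : ℝ) := by
          rw [show (4 : ℝ) = 2 ^ (2 : ℝ) by norm_num, ← Real.rpow_mul (by norm_num)]; norm_num
  -- assemble: `(Lg^{4/π}/n)² = (Lg^{4/π})²/n² ≤ 686 n^{1/2}/n² = 686 n^{-3/2}`
  rw [div_pow]
  rw [div_le_iff₀ (by positivity)]
  calc (Lg ^ (4 / π)) ^ 2 ≤ 343 * y ^ (1 / 2 : ℝ) := hsq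
    _ ≤ 343 * (2 * (n : ℝ) ^ (1 / 2 : ℝ)) := by gcongr
    _ = 686 * (n : ℝ) ^ (-(3 / 2 : ℝ)) * (n : ℝ) ^ 2 := by
        rw [show ((n : ℝ)) ^ 2 = (n : ℝ) ^ (2 : ℝ) by rw [Real.rpow_two], mul_assoc,
          ← Real.rpow_add hn0]
        norm_num
        ring

/-- The squared window weights `w_0 = 1`, `w_m = (1+log(3+|m|))^{4/π}/|m|` are summable over
`m ∈ ℤ`. [folklore] -/
theorem summable_window_weight_sq :
    Summable fun m : ℤ =>
      (if m = 0 then (1 : ℝ) else (1 + Real.log (3 + |(m : ℝ)|)) ^ (4 / π) / |(m : ℝ)|) ^ 2 := by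
  set w : ℤ → ℝ := fun m =>
    (if m = 0 then (1 : ℝ) else (1 + Real.log (3 + |(m : ℝ)|)) ^ (4 / π) / |(m : ℝ)|) ^ 2 with hw
  have hsymm : ∀ n : ℕ, w (-(n : ℤ)) = w n := by
    intro n; simp only [hw, neg_eq_zero, Int.cast_neg, abs_neg]
  -- summability over `ℕ`: compare `w (n+1)` with `686 (n+1)^{-3/2}`
  have hnat : Summable fun n : ℕ => w n := by
    rw [← summable_nat_add_iff 1]
    have hmaj : Summable fun n : ℕ => 686 * (((n + 1 : ℕ) : ℝ)) ^ (-(3 / 2 : ℝ)) := by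
      have h := (Real.summable_nat_rpow.2 (by norm_num : (-(3 / 2 : ℝ)) < -1)).mul_left 686
      exact (summable_nat_add_iff 1).2 h
    refine Summable.of_nonneg_of_le (fun n => by positivity) (fun n => ?_) hmaj
    have hn1 : 1 ≤ n + 1 := by omega
    simp only [hw]
    rw [if_neg (by omega)]
    have habs : |((n + 1 : ℕ) : ℤ)| = ((n + 1 : ℕ) : ℤ) := abs_of_nonneg (by positivity)
    push_cast
    rw [abs_of_nonneg (by positivity : (0 : ℝ) ≤ (n : ℝ) + 1)]
    have := window_weight_sq_le hn1
    push_cast at this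
    exact this
  refine Summable.of_nat_of_neg hnat ?_
  simpa only [hsymm] using hnat

/-! ### §4. Integrals over `ℝ` decomposed into the unit windows `(m − 1/2, m + 1/2]` -/

/-- The unit windows centred at the integers cover `ℝ`. [folklore] -/
theorem iUnion_window_eq_univ :
    (⋃ m : ℤ, Set.Ioc ((m : ℝ) - 1 / 2) ((m : ℝ) + 1 / 2)) = Set.univ := by
  refine Set.eq_univ_of_forall fun y => Set.mem_iUnion.2 ⟨⌈y - 1 / 2⌉, ?_, ?_⟩
  · have := Int.ceil_lt_add_one (y - 1 / 2); linarith
  · have := Int.le_ceil (y - 1 / 2); linarith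

/-- The unit windows centred at the integers are pairwise disjoint. [folklore] -/
theorem pairwise_disjoint_window :
    Pairwise (Function.onFun Disjoint fun m : ℤ => Set.Ioc ((m : ℝ) - 1 / 2) ((m : ℝ) + 1 / 2)) := by
  intro m n hmn
  show Disjoint (Set.Ioc ((m : ℝ) - 1 / 2) ((m : ℝ) + 1 / 2)) (Set.Ioc ((n : ℝ) - 1 / 2) ((n : ℝ) + 1 / 2))
  rw [Set.Ioc_disjoint_Ioc]
  rcases lt_or_gt_of_ne hmn with h | h
  · have : (m : ℝ) + 1 ≤ n := by exact_mod_cast h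
    calc min ((m : ℝ) + 1 / 2) ((n : ℝ) + 1 / 2) ≤ (m : ℝ) + 1 / 2 := min_le_left _ _
      _ ≤ (n : ℝ) - 1 / 2 := by linarith
      _ ≤ max ((m : ℝ) - 1 / 2) ((n : ℝ) - 1 / 2) := le_max_right _ _
  · have : (n : ℝ) + 1 ≤ m := by exact_mod_cast h
    calc min ((m : ℝ) + 1 / 2) ((n : ℝ) + 1 / 2) ≤ (n : ℝ) + 1 / 2 := min_le_right _ _
      _ ≤ (m : ℝ) - 1 / 2 := by linarith
      _ ≤ max ((m : ℝ) - 1 / 2) ((n : ℝ) - 1 / 2) := le_max_left _ _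

/-- **Summing window bounds**: if `g ≥ 0` is integrable on each window with
`∫_{(m−1/2, m+1/2]} g ≤ b_m` and `Σ b_m < ∞`, then `g` is integrable on `ℝ` and `∫_ℝ g ≤ Σ_m b_m`.
[folklore] -/
theorem integral_le_tsum_of_windows {g : ℝ → ℝ} (hg0 : ∀ y, 0 ≤ g y)
    (hint : ∀ m : ℤ, IntegrableOn g (Set.Ioc ((m : ℝ) - 1 / 2) ((m : ℝ) + 1 / 2)))
    {b : ℤ → ℝ} (hle : ∀ m : ℤ, ∫ y in Set.Ioc ((m : ℝ) - 1 / 2) ((m : ℝ) + 1 / 2), g y ≤ b m)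
    (hb : Summable b) :
    Integrable g ∧ ∫ y, g y ≤ ∑' m, b m := by
  set s : ℤ → Set ℝ := fun m => Set.Ioc ((m : ℝ) - 1 / 2) ((m : ℝ) + 1 / 2) with hs
  have hsm : ∀ m, MeasurableSet (s m) := fun m => measurableSet_Ioc
  have hnorm : ∀ m, ∫ y in s m, ‖g y‖ = ∫ y in s m, g y := fun m =>
    integral_congr_ae (Filter.Eventually.of_forall fun y => by
      simp only [Real.norm_eq_abs, abs_of_nonneg (hg0 y)])
  have h0 : ∀ m, 0 ≤ ∫ y in s m, g y := fun m => integral_nonneg fun y => hg0 y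
  have hsum : Summable fun m => ∫ y in s m, ‖g y‖ := by
    refine Summable.of_nonneg_of_le (fun m => ?_) (fun m => ?_) hb
    · rw [hnorm]; exact h0 m
    · rw [hnorm]; exact hle m
  have hI : IntegrableOn g (⋃ m, s m) := integrableOn_iUnion_of_summable_integral_norm hint hsum
  have huniv : (⋃ m, s m) = Set.univ := iUnion_window_eq_univ
  have hIg : Integrable g := by rwa [huniv, integrableOn_univ] at hI
  refine ⟨hIg, ?_⟩
  have heq : ∫ y, g y = ∑' m, ∫ y in s m, g y := by
    rw [← setIntegral_univ, ← huniv]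
    exact integral_iUnion hsm pairwise_disjoint_window hI
  rw [heq]
  exact Summable.tsum_le_tsum hle ((hasSum_integral_iUnion hsm pairwise_disjoint_window hI).summable) hb

/-- `∫_ℝ dy/(α² + y²) = π/α` for `α > 0`. [folklore] -/
theorem integral_inv_sq_add_sq {α : ℝ} (hα : 0 < α) :
    ∫ y : ℝ, (α ^ 2 + y ^ 2)⁻¹ = π / α := by
  have h := Measure.integral_comp_mul_left (fun y : ℝ => (α ^ 2 + y ^ 2)⁻¹) α
  have heq : (fun y : ℝ => (α ^ 2 + (α * y) ^ 2)⁻¹) = fun y : ℝ => (α ^ 2)⁻¹ * (1 + y ^ 2)⁻¹ := by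
    funext y
    rw [← mul_inv, mul_add, mul_one, mul_pow]
  rw [heq, integral_const_mul, integral_univ_inv_one_add_sq, abs_of_pos (inv_pos.2 hα), smul_eq_mul] at h
  -- `h : (α²)⁻¹ π = α⁻¹ ∫ …`
  have h2 : ∫ y : ℝ, (α ^ 2 + y ^ 2)⁻¹ = α * ((α ^ 2)⁻¹ * π) := by
    rw [h]; field_simp
  rw [h2]; field_simp

/-- `y ↦ 1/(α² + y²)` is integrable on `ℝ` (`α ≠ 0`). [folklore] -/
theorem integrable_inv_sq_add_sq {α : ℝ} (hα : 0 < α) :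
    Integrable fun y : ℝ => (α ^ 2 + y ^ 2)⁻¹ := by
  have h := (integrable_inv_one_add_sq.comp_mul_left' (inv_ne_zero hα.ne')).const_mul (α ^ 2)⁻¹
  refine h.congr (Filter.Eventually.of_forall fun y => ?_)
  show (α ^ 2)⁻¹ * (1 + (α⁻¹ * y) ^ 2)⁻¹ = (α ^ 2 + y ^ 2)⁻¹
  rw [← mul_inv]
  congr 1
  field_simp

/-- `‖α + iy‖² = α² + y²`. [folklore] -/
theorem norm_sq_add_mul_I (α y : ℝ) : ‖(α : ℂ) + y * I‖ ^ 2 = α ^ 2 + y ^ 2 := by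
  rw [Complex.sq_norm, Complex.normSq_apply]
  simp
  ring

/-- `∫_{window} dy/‖α+iy‖² ≤ π/α` (`α > 0`). [folklore] -/
theorem setIntegral_window_inv_norm_sq_le {α : ℝ} (hα : 0 < α) (m : ℤ) :
    ∫ y in Set.Ioc ((m : ℝ) - 1 / 2) ((m : ℝ) + 1 / 2), (‖(α : ℂ) + y * I‖ ^ 2)⁻¹ ≤ π / α := by
  simp_rw [norm_sq_add_mul_I]
  rw [← integral_inv_sq_add_sq hα]
  exact setIntegral_le_integral (integrable_inv_sq_add_sq hα) (Filter.Eventually.of_forall fun y => by positivity)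

/-! ### §5. The mean square `J(α) = ∫ u² |S₁(e^u)|² e^{−2αu} du` -/

/-- Continuity of `y ↦ F(1+α+iy)` and `y ↦ P(1+α+iy)` along the line (`α > 0`). [folklore] -/
theorem continuous_LSeries_line' (f : ℕ →*₀ ℂ) (hf : ∀ n, ‖f n‖ ≤ 1) {α : ℝ} (hα : 0 < α) :
    Continuous (fun y : ℝ => LSeries (f ·) ((1 : ℂ) + α + y * I)) ∧
      Continuous (fun y : ℝ => LSeries (fun n => f n * (Λ n : ℂ)) ((1 : ℂ) + α + y * I)) := by
  have hσ : (1 : ℝ) < 1 + α := by linarith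
  have h1 : Summable fun n : ℕ => ‖f n‖ / (n : ℝ) ^ (1 + α) := by
    refine Summable.of_nonneg_of_le (fun n => by positivity) (fun n => ?_)
      (Real.summable_one_div_nat_rpow.2 hσ)
    exact div_le_div_of_nonneg_right (hf n) (by positivity)
  have h2 : Summable fun n : ℕ => ‖f n * (Λ n : ℂ)‖ / (n : ℝ) ^ (1 + α) := by
    have := summable_norm_twistedFVM_div_rpow f hf 0 hσ
    refine this.congr fun n => ?_
    rcases Nat.eq_zero_or_pos n with rfl | hn
    · simp
    · rw [norm_mul, norm_mul, norm_natCast_cpow_neg_mul_I hn, mul_one]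
  have hc1 := Halasz.continuous_LSeries_line (a := (f ·)) (σ := 1 + α) h1
  have hc2 := Halasz.continuous_LSeries_line (a := fun n => f n * (Λ n : ℂ)) (σ := 1 + α) h2
  have he : ∀ y : ℝ, (((1 + α : ℝ)) : ℂ) + y * I = (1 : ℂ) + α + y * I := fun y => by push_cast; ring
  simp only [he] at hc1 hc2
  exact ⟨hc1, hc2⟩

/-- **`J(α) ≤ K_J |F(σ)|² R(α)² / α`** (Roy–Vatwani (eq:T1step1general) with Lemma 7.3 inserted,
`k = 1`): there is an absolute `K_J` such that for all totally multiplicative `f` with `|f| ≤ 1`,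
`1 < σ ≤ 2`, `0 < α ≤ 1`,
`∫_ℝ u² |S₁(e^u)|² e^{−2αu} du ≤ K_J |F(σ)|² (δ/α² + δ^{1−4/π}/α + α^{1−4/π}/δ)² / α`.
[cite: RoyVatwani2019, §6.1 (eq:T1step1general) and Lemma 7.3] -/
theorem exists_meanSquare_le :
    ∃ KJ : ℝ, 0 < KJ ∧ ∀ f : ℕ →*₀ ℂ, (∀ n, ‖f n‖ ≤ 1) → ∀ σ : ℝ, 1 < σ → σ ≤ 2 →
      ∀ α : ℝ, 0 < α → α ≤ 1 →
        ∫ u : ℝ, u ^ 2 * ‖S₁ f (Real.exp u)‖ ^ 2 * Real.exp (-(2 * α * u)) ≤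
          KJ * ‖LSeries (f ·) σ‖ ^ 2 *
            ((σ - 1) / α ^ 2 + (σ - 1) ^ (1 - 4 / π) / α + α ^ (1 - 4 / π) / (σ - 1)) ^ 2 / α := by
  obtain ⟨C₁, hC₁, hL1⟩ := MontgomeryVaughan2001_lemma1_holds
  obtain ⟨C₂, hC₂, hL2⟩ := MontgomeryVaughan2001_lemma2_holds
  set W₂ : ℝ := ∑' m : ℤ,
    (if m = 0 then (1 : ℝ) else (1 + Real.log (3 + |(m : ℝ)|)) ^ (4 / π) / |(m : ℝ)|) ^ 2 with hW₂
  have hW₂0 : 0 ≤ W₂ := tsum_nonneg fun m => by positivity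
  set KB : ℝ := 36 * C₁ * C₂ with hKB
  have hKB0 : 0 < KB := by positivity
  refine ⟨(1008 / (2 * π)) * KB ^ 2 * W₂ + 1, by positivity, fun f hf σ hσ hσ2 α hα hα1 => ?_⟩
  have hδ : 0 < σ - 1 := by linarith
  set Fσ : ℝ := ‖LSeries (f ·) σ‖ with hFσ
  have hF0 : 0 ≤ Fσ := norm_nonneg _
  set R : ℝ := (σ - 1) / α ^ 2 + (σ - 1) ^ (1 - 4 / π) / α + α ^ (1 - 4 / π) / (σ - 1) with hR
  have hR0 : 0 ≤ R := by positivity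
  set w : ℤ → ℝ := fun m =>
    if m = 0 then (1 : ℝ) else (1 + Real.log (3 + |(m : ℝ)|)) ^ (4 / π) / |(m : ℝ)| with hw
  have hw0 : ∀ m, 0 ≤ w m := fun m => by
    simp only [hw]; split_ifs
    · norm_num
    · have : 0 ≤ Real.log (3 + |(m : ℝ)|) := Real.log_nonneg (by linarith [abs_nonneg (m : ℝ)])
      positivity
  have hwsum : Summable fun m : ℤ => w m ^ 2 := summable_window_weight_sq
  -- the pointwise window majorant
  have hmaj : ∀ m : ℤ, ∀ y ∈ Set.Ioc ((m : ℝ) - 1 / 2) ((m : ℝ) + 1 / 2),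
      ‖LSeries (f ·) ((1 : ℂ) + α + y * I)‖ / ‖(α : ℂ) + y * I‖ ≤ KB * Fσ * R * w m := by
    intro m y hy
    have hpt : (((1 + α : ℝ)) : ℂ) + y * I = (1 : ℂ) + α + y * I := by push_cast; ring
    have hym : |y - m| ≤ 1 / 2 := by rw [abs_le]; constructor <;> linarith [hy.1, hy.2]
    by_cases hm : m = 0
    · subst hm
      simp only [hw, if_pos rfl, mul_one]
      have hy0 : |y| ≤ 1 / 2 := by simpa using hym
      have h := window_majorant_zero hC₁ hC₂ hL1 hL2 f hf hσ hσ2 hα hα1 hy0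
      rw [hpt] at h
      refine h.trans ?_
      have : 4 * C₁ * C₂ ≤ KB := by rw [hKB]; nlinarith
      gcongr
    · simp only [hw, if_neg hm]
      have h := window_majorant_ne_zero hC₁ hC₂ hL1 hL2 f hf hσ hσ2 hα hα1 hm hym
      rw [hpt] at h
      exact h
  -- the integrand and its per-window bound
  set g : ℝ → ℝ := fun y => ‖deriv (LSeries (f ·)) (1 + α + y * I) / (α + y * I) -
      LSeries (f ·) (1 + α + y * I) / ((α : ℂ) + y * I) ^ 2‖ ^ 2 with hg
  have hre : ∀ y : ℝ, 1 < ((1 : ℂ) + α + y * I).re := fun y => by simp; linarith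
  have hs0 : ∀ y : ℝ, ((α : ℂ) + y * I) ≠ 0 := fun y h => by
    have := congrArg Complex.re h; simp at this; linarith
  -- pointwise: `g y ≤ 2 B_m² ‖P‖² + 2 B_m² / ‖α+iy‖²`
  have hgle : ∀ m : ℤ, ∀ y ∈ Set.Ioc ((m : ℝ) - 1 / 2) ((m : ℝ) + 1 / 2),
      g y ≤ 2 * (KB * Fσ * R * w m) ^ 2 * ‖LSeries (fun n => f n * (Λ n : ℂ)) ((1 : ℂ) + α + y * I)‖ ^ 2 +
        2 * (KB * Fσ * R * w m) ^ 2 * (‖(α : ℂ) + y * I‖ ^ 2)⁻¹ := by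
    intro m y hy
    have hB := hmaj m y hy
    set Bm := KB * Fσ * R * w m with hBm
    have hD0 : 0 < ‖(α : ℂ) + y * I‖ := norm_pos_iff.2 (hs0 y)
    set D := ‖(α : ℂ) + y * I‖ with hD
    set NF := ‖LSeries (f ·) ((1 : ℂ) + α + y * I)‖ with hNF
    set NP := ‖LSeries (fun n => f n * (Λ n : ℂ)) ((1 : ℂ) + α + y * I)‖ with hNP
    have hNFD : NF / D ≤ Bm := hB
    have hBm0 : 0 ≤ Bm := le_trans (by positivity) hNFD
    have hderiv : ‖deriv (LSeries (f ·)) (1 + α + y * I)‖ = NP * NF := norm_deriv_LSeries_eq f hf (hre y)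
    simp only [hg]
    have h1 : ‖deriv (LSeries (f ·)) (1 + α + y * I) / (α + y * I)‖ = NP * (NF / D) := by
      rw [norm_div, hderiv, ← hD]; ring
    have h2 : ‖LSeries (f ·) (1 + α + y * I) / ((α : ℂ) + y * I) ^ 2‖ = (NF / D) / D := by
      rw [norm_div, norm_pow, ← hD, ← hNF]; field_simp
    calc ‖deriv (LSeries (f ·)) (1 + α + y * I) / (α + y * I) -
          LSeries (f ·) (1 + α + y * I) / ((α : ℂ) + y * I) ^ 2‖ ^ 2
        ≤ (‖deriv (LSeries (f ·)) (1 + α + y * I) / (α + y * I)‖ +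
            ‖LSeries (f ·) (1 + α + y * I) / ((α : ℂ) + y * I) ^ 2‖) ^ 2 := by
          gcongr; exact norm_sub_le _ _
      _ = (NP * (NF / D) + (NF / D) / D) ^ 2 := by rw [h1, h2]
      _ ≤ 2 * (NP * (NF / D)) ^ 2 + 2 * ((NF / D) / D) ^ 2 := by
          nlinarith [sq_nonneg (NP * (NF / D) - NF / D / D)]
      _ ≤ 2 * (NP * Bm) ^ 2 + 2 * (Bm / D) ^ 2 := by
          have hNP0 : 0 ≤ NP := norm_nonneg _
          have hq0 : 0 ≤ NF / D := div_nonneg (norm_nonneg _) hD0.le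
          have ha : NP * (NF / D) ≤ NP * Bm := mul_le_mul_of_nonneg_left hNFD hNP0
          have hb : NF / D / D ≤ Bm / D := div_le_div_of_nonneg_right hNFD hD0.le
          have ha0 : 0 ≤ NP * (NF / D) := mul_nonneg hNP0 hq0
          have hb0 : 0 ≤ NF / D / D := div_nonneg hq0 hD0.le
          nlinarith [mul_self_le_mul_self ha0 ha, mul_self_le_mul_self hb0 hb]
      _ = 2 * Bm ^ 2 * NP ^ 2 + 2 * Bm ^ 2 * (D ^ 2)⁻¹ := by field_simp
  -- continuity (hence local integrability) of `g`
  obtain ⟨hcF, hcP⟩ := continuous_LSeries_line' f hf hα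
  have hcs : Continuous fun y : ℝ => ((α : ℂ) + y * I) := by fun_prop
  have hcg : Continuous g := by
    simp only [hg]
    have hd : Continuous fun y : ℝ => deriv (LSeries (f ·)) (1 + α + y * I) := by
      have heq : (fun y : ℝ => deriv (LSeries (f ·)) (1 + α + y * I)) = fun y : ℝ =>
          -(LSeries (fun n => f n * (Λ n : ℂ)) ((1 : ℂ) + α + y * I) * LSeries (f ·) ((1 : ℂ) + α + y * I)) := by
        funext y; exact deriv_LSeries_eq_neg_mul f hf (hre y)
      rw [heq]; exact (hcP.mul hcF).neg
    refine ((hd.div hcs hs0).sub (hcF.div (hcs.pow 2) fun y => pow_ne_zero 2 (hs0 y))).norm.pow 2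
  have hg0 : ∀ y, 0 ≤ g y := fun y => by simp only [hg]; positivity
  have hgint : ∀ m : ℤ, IntegrableOn g (Set.Ioc ((m : ℝ) - 1 / 2) ((m : ℝ) + 1 / 2)) := fun m =>
    hcg.integrableOn_Ioc
  -- per-window integral bound
  have hwin : ∀ m : ℤ, ∫ y in Set.Ioc ((m : ℝ) - 1 / 2) ((m : ℝ) + 1 / 2), g y ≤
      (KB * Fσ * R * w m) ^ 2 * (1008 / α) := by
    intro m
    set Bm := KB * Fσ * R * w m with hBm
    have hP := window_integral_norm_LSeries_mulVM_sq_le f hf hα hα1 (m : ℝ)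
    rw [intervalIntegral.integral_of_le (by linarith)] at hP
    have hPint : IntegrableOn (fun y : ℝ => ‖LSeries (fun n => f n * (Λ n : ℂ)) ((1 : ℂ) + α + y * I)‖ ^ 2)
        (Set.Ioc ((m : ℝ) - 1 / 2) ((m : ℝ) + 1 / 2)) := (hcP.norm.pow 2).integrableOn_Ioc
    have hQint : IntegrableOn (fun y : ℝ => (‖(α : ℂ) + y * I‖ ^ 2)⁻¹)
        (Set.Ioc ((m : ℝ) - 1 / 2) ((m : ℝ) + 1 / 2)) :=
      ((hcs.norm.pow 2).inv₀ fun y => pow_ne_zero 2 (norm_ne_zero_iff.2 (hs0 y))).integrableOn_Ioc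
    have hQ := setIntegral_window_inv_norm_sq_le hα m
    have hπ4 : π / α ≤ 4 / α := div_le_div_of_nonneg_right Real.pi_le_four hα.le
    have hsumint : IntegrableOn (fun y : ℝ =>
        2 * Bm ^ 2 * ‖LSeries (fun n => f n * (Λ n : ℂ)) ((1 : ℂ) + α + y * I)‖ ^ 2 +
          2 * Bm ^ 2 * (‖(α : ℂ) + y * I‖ ^ 2)⁻¹) (Set.Ioc ((m : ℝ) - 1 / 2) ((m : ℝ) + 1 / 2)) :=
      (hPint.const_mul _).add (hQint.const_mul _)
    calc ∫ y in Set.Ioc ((m : ℝ) - 1 / 2) ((m : ℝ) + 1 / 2), g y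
        ≤ ∫ y in Set.Ioc ((m : ℝ) - 1 / 2) ((m : ℝ) + 1 / 2),
            (2 * Bm ^ 2 * ‖LSeries (fun n => f n * (Λ n : ℂ)) ((1 : ℂ) + α + y * I)‖ ^ 2 +
              2 * Bm ^ 2 * (‖(α : ℂ) + y * I‖ ^ 2)⁻¹) :=
          setIntegral_mono_on (hgint m) hsumint measurableSet_Ioc (hgle m)
      _ = (2 * Bm ^ 2 * ∫ y in Set.Ioc ((m : ℝ) - 1 / 2) ((m : ℝ) + 1 / 2),
            ‖LSeries (fun n => f n * (Λ n : ℂ)) ((1 : ℂ) + α + y * I)‖ ^ 2) +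
          2 * Bm ^ 2 * ∫ y in Set.Ioc ((m : ℝ) - 1 / 2) ((m : ℝ) + 1 / 2), (‖(α : ℂ) + y * I‖ ^ 2)⁻¹ := by
          rw [integral_add (hPint.const_mul _) (hQint.const_mul _), MeasureTheory.integral_const_mul,
            MeasureTheory.integral_const_mul]
      _ ≤ 2 * Bm ^ 2 * (500 / α) + 2 * Bm ^ 2 * (4 / α) := by
          have hP' : ∫ y in Set.Ioc ((m : ℝ) - 1 / 2) ((m : ℝ) + 1 / 2),
              ‖LSeries (fun n => f n * (Λ n : ℂ)) ((1 : ℂ) + α + y * I)‖ ^ 2 ≤ 500 / α := by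
            refine le_trans (le_of_eq ?_) hP
            refine integral_congr_ae (Filter.Eventually.of_forall fun y => ?_)
            push_cast; ring_nf
          gcongr
          exact hQ.trans hπ4
      _ = Bm ^ 2 * (1008 / α) := by ring
  -- sum over the windows
  have hbsum : Summable fun m : ℤ => (KB * Fσ * R * w m) ^ 2 * (1008 / α) := by
    have := (hwsum.mul_left ((KB * Fσ * R) ^ 2 * (1008 / α)))
    refine this.congr fun m => ?_
    ring
  obtain ⟨hgI, hgle'⟩ := integral_le_tsum_of_windows hg0 hgint hwin hbsum
  have htsum : ∑' m : ℤ, (KB * Fσ * R * w m) ^ 2 * (1008 / α) = (KB * Fσ * R) ^ 2 * (1008 / α) * W₂ := by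
    rw [hW₂, ← tsum_mul_left]
    refine tsum_congr fun m => ?_
    simp only [hw]; ring
  -- Plancherel
  rw [integral_sq_mul_norm_S₁_sq_eq f hf hα]
  have hπ0 : 0 < 1 / (2 * π) := by positivity
  calc 1 / (2 * π) * ∫ y : ℝ, g y ≤ 1 / (2 * π) * ((KB * Fσ * R) ^ 2 * (1008 / α) * W₂) := by
        rw [← htsum]; exact mul_le_mul_of_nonneg_left hgle' hπ0.le
    _ = (1008 / (2 * π) * KB ^ 2 * W₂) * Fσ ^ 2 * R ^ 2 / α := by field_simp
    _ ≤ (1008 / (2 * π) * KB ^ 2 * W₂ + 1) * Fσ ^ 2 * R ^ 2 / α :=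
        div_le_div_of_nonneg_right (mul_le_mul_of_nonneg_right
          (mul_le_mul_of_nonneg_right (by linarith) (sq_nonneg _)) (sq_nonneg _)) hα.le

/-! ### §6. From the mean square to `G(v) = ∫_0^v |S₁(e^w)| w dw` (Cauchy–Schwarz) -/

/-- `|S₁(e^u)| ≤ 1 + u` for `u ≥ 0` (harmonic bound). [folklore] -/
theorem norm_S₁_exp_le (f : ℕ →*₀ ℂ) (hf : ∀ n, ‖f n‖ ≤ 1) {u : ℝ} (hu : 0 ≤ u) :
    ‖S₁ f (Real.exp u)‖ ≤ 1 + u := by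
  refine (norm_S₁_le f hf _).trans ((sum_Icc_one_div_le_one_add_log ⌊Real.exp u⌋₊).trans ?_)
  have h1 : (1 : ℝ) ≤ ⌊Real.exp u⌋₊ := by
    have : 1 ≤ ⌊Real.exp u⌋₊ := Nat.le_floor (by simpa using Real.one_le_exp hu)
    exact_mod_cast this
  have : Real.log (⌊Real.exp u⌋₊ : ℝ) ≤ u := by
    calc Real.log (⌊Real.exp u⌋₊ : ℝ) ≤ Real.log (Real.exp u) :=
          Real.log_le_log (by linarith) (Nat.floor_le (Real.exp_pos u).le)
      _ = u := Real.log_exp u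
  linarith

/-- `(1+u)⁴ e^{−αu} ≤ 24 e/α⁴` for `u ≥ 0`, `0 < α ≤ 1` (Taylor: `e^{x} ≥ x⁴/4!` at `x = α(1+u)`).
[folklore] -/
theorem one_add_pow_four_mul_exp_le {α u : ℝ} (hα : 0 < α) (hα1 : α ≤ 1) (hu : 0 ≤ u) :
    (1 + u) ^ 4 * Real.exp (-(α * u)) ≤ 24 * Real.exp 1 / α ^ 4 := by
  have hx : 0 ≤ α * (1 + u) := by positivity
  have h := Real.pow_div_factorial_le_exp (α * (1 + u)) hx 4
  have hfac : ((Nat.factorial 4 : ℕ) : ℝ) = 24 := by norm_num [Nat.factorial]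
  rw [hfac] at h
  -- `(α(1+u))⁴/24 ≤ e^{α(1+u)} = e^{α} e^{αu} ≤ e · e^{αu}`
  have h2 : Real.exp (α * (1 + u)) ≤ Real.exp 1 * Real.exp (α * u) := by
    rw [← Real.exp_add]; exact Real.exp_le_exp.2 (by nlinarith)
  have h3 : (α * (1 + u)) ^ 4 / 24 ≤ Real.exp 1 * Real.exp (α * u) := h.trans h2
  rw [Real.exp_neg, ← div_eq_mul_inv, div_le_div_iff₀ (Real.exp_pos _) (by positivity)]
  have : (α * (1 + u)) ^ 4 = α ^ 4 * (1 + u) ^ 4 := by ring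
  nlinarith [Real.exp_pos (α * u)]

/-- **Integrability of the mean-square integrand** `u² |S₁(e^u)|² e^{−2αu}` (`0 < α ≤ 1`), by the
majorant `(24e/α⁴) e^{−αu}` on `u ≥ 0`. [folklore] -/
theorem integrable_meanSquare_integrand (f : ℕ →*₀ ℂ) (hf : ∀ n, ‖f n‖ ≤ 1) {α : ℝ} (hα : 0 < α)
    (hα1 : α ≤ 1) :
    Integrable fun u : ℝ => u ^ 2 * ‖S₁ f (Real.exp u)‖ ^ 2 * Real.exp (-(2 * α * u)) := by
  set C : ℝ := 24 * Real.exp 1 / α ^ 4 with hC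
  have hg : Integrable ((Set.Ici (0 : ℝ)).indicator (fun u => C * Real.exp (-(α * u)))) := by
    rw [integrable_indicator_iff measurableSet_Ici, integrableOn_Ici_iff_integrableOn_Ioi]
    have h0 : IntegrableOn (fun u : ℝ => C * Real.exp (-α * u)) (Set.Ioi 0) :=
      (exp_neg_integrableOn_Ioi 0 hα).const_mul C
    refine IntegrableOn.congr_fun h0 (fun u _ => ?_) measurableSet_Ioi
    show C * Real.exp (-α * u) = C * Real.exp (-(α * u)); rw [neg_mul]
  have hmeas : Measurable fun u : ℝ => u ^ 2 * ‖S₁ f (Real.exp u)‖ ^ 2 * Real.exp (-(2 * α * u)) :=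
    ((measurable_id.pow_const 2).mul (((measurable_norm_S₁ f).comp Real.measurable_exp).pow_const 2)).mul
      (Real.measurable_exp.comp (by fun_prop))
  refine hg.mono' hmeas.aestronglyMeasurable (Filter.Eventually.of_forall fun u => ?_)
  rw [Real.norm_eq_abs, abs_of_nonneg (by positivity)]
  rcases lt_or_ge u 0 with hu | hu
  · rw [Set.indicator_of_notMem (by simpa using hu), S₁_of_lt_one f (Real.exp_lt_one_iff.2 hu), norm_zero]
    simp
  · rw [Set.indicator_of_mem (by exact hu)]
    have hS := norm_S₁_exp_le f hf hu
    have h4 := one_add_pow_four_mul_exp_le hα hα1 hu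
    have hsplit : Real.exp (-(2 * α * u)) = Real.exp (-(α * u)) * Real.exp (-(α * u)) := by
      rw [← Real.exp_add]; congr 1; ring
    have hu2 : u ^ 2 * ‖S₁ f (Real.exp u)‖ ^ 2 ≤ (1 + u) ^ 4 := by
      have h1 : u ^ 2 ≤ (1 + u) ^ 2 := by nlinarith
      have h2 : ‖S₁ f (Real.exp u)‖ ^ 2 ≤ (1 + u) ^ 2 := pow_le_pow_left₀ (norm_nonneg _) hS 2
      calc u ^ 2 * ‖S₁ f (Real.exp u)‖ ^ 2 ≤ (1 + u) ^ 2 * (1 + u) ^ 2 :=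
            mul_le_mul h1 h2 (by positivity) (by positivity)
        _ = (1 + u) ^ 4 := by ring
    calc u ^ 2 * ‖S₁ f (Real.exp u)‖ ^ 2 * Real.exp (-(2 * α * u))
        ≤ (1 + u) ^ 4 * Real.exp (-(2 * α * u)) := mul_le_mul_of_nonneg_right hu2 (Real.exp_pos _).le
      _ = ((1 + u) ^ 4 * Real.exp (-(α * u))) * Real.exp (-(α * u)) := by rw [hsplit]; ring
      _ ≤ C * Real.exp (-(α * u)) := mul_le_mul_of_nonneg_right h4 (Real.exp_pos _).le

/-- **Cauchy–Schwarz on `[0, v]`** (Roy–Vatwani, display before (eq:T1step1general)): for `v ≥ 2`,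
`∫_0^v |S₁(e^w)| w dw ≤ (e²/2) √v · √(2 J(2/v) v)`-type bound; precisely, with `J = J(2/v)`,
`∫_0^v |S₁(e^w)| w dw ≤ e² √v √J`. [cite: RoyVatwani2019, §6.1 (eq:T1 step1)] -/
theorem integral_norm_S₁_mul_le (f : ℕ →*₀ ℂ) (hf : ∀ n, ‖f n‖ ≤ 1) {v : ℝ} (hv : 2 ≤ v) :
    ∫ w in (0 : ℝ)..v, ‖S₁ f (Real.exp w)‖ * w ≤
      Real.exp 2 * Real.sqrt v *
        Real.sqrt (∫ u : ℝ, u ^ 2 * ‖S₁ f (Real.exp u)‖ ^ 2 * Real.exp (-(2 * (2 / v) * u))) := by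
  have hv0 : 0 < v := by linarith
  set α : ℝ := 2 / v with hαdef
  have hα : 0 < α := by positivity
  have hα1 : α ≤ 1 := by rw [hαdef, div_le_one hv0]; linarith
  have hαv : α * v = 2 := by rw [hαdef]; field_simp
  set J : ℝ := ∫ u : ℝ, u ^ 2 * ‖S₁ f (Real.exp u)‖ ^ 2 * Real.exp (-(2 * α * u)) with hJ
  have hJint := integrable_meanSquare_integrand f hf hα hα1
  have hJ0 : 0 ≤ J := integral_nonneg fun u => by positivity
  set μ : Measure ℝ := volume.restrict (Set.Ioc 0 v) with hμ
  haveI : IsFiniteMeasure μ := by rw [hμ]; infer_instance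
  -- the two factors
  set φ : ℝ → ℝ := fun w => ‖S₁ f (Real.exp w)‖ * w * Real.exp (-(α * w)) with hφ
  set ψ : ℝ → ℝ := fun w => Real.exp (α * w) with hψ
  have hφmeas : AEStronglyMeasurable φ μ := by
    refine (Measurable.aestronglyMeasurable ?_)
    exact ((((measurable_norm_S₁ f).comp Real.measurable_exp).mul measurable_id)).mul
      (Real.measurable_exp.comp (by fun_prop))
  have hψmeas : AEStronglyMeasurable ψ μ := (by fun_prop : Continuous ψ).aestronglyMeasurable
  have hφbd : ∀ᵐ w ∂μ, ‖φ w‖ ≤ (1 + v) * v := by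
    refine ae_restrict_of_forall_mem measurableSet_Ioc fun w hw => ?_
    simp only [hφ, Real.norm_eq_abs]
    rw [abs_of_nonneg (by have := hw.1.le; positivity)]
    have h1 := norm_S₁_exp_le f hf hw.1.le
    have h2 : Real.exp (-(α * w)) ≤ 1 := Real.exp_le_one_iff.2 (by nlinarith [hw.1])
    calc ‖S₁ f (Real.exp w)‖ * w * Real.exp (-(α * w)) ≤ (1 + v) * v * 1 := by
          refine mul_le_mul (mul_le_mul (by linarith [hw.2]) hw.2 hw.1.le (by linarith)) h2
            (Real.exp_pos _).le (by positivity)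
      _ = (1 + v) * v := mul_one _
  have hψbd : ∀ᵐ w ∂μ, ‖ψ w‖ ≤ Real.exp 2 := by
    refine ae_restrict_of_forall_mem measurableSet_Ioc fun w hw => ?_
    simp only [hψ, Real.norm_eq_abs, abs_of_pos (Real.exp_pos _), Real.exp_le_exp]
    nlinarith [hw.2]
  have hφmem : MemLp φ (ENNReal.ofReal 2) μ := by
    rw [ENNReal.ofReal_ofNat]; exact MemLp.of_bound hφmeas _ hφbd
  have hψmem : MemLp ψ (ENNReal.ofReal 2) μ := by
    rw [ENNReal.ofReal_ofNat]; exact MemLp.of_bound hψmeas _ hψbd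
  have hH := integral_mul_le_Lp_mul_Lq_of_nonneg (μ := μ) Real.HolderConjugate.two_two
    (Filter.Eventually.of_forall fun w => by
      simp only [hφ, Pi.zero_apply]
      rcases lt_or_ge w 0 with hw | hw
      · rw [S₁_of_lt_one f (Real.exp_lt_one_iff.2 hw), norm_zero]; simp
      · positivity)
    (Filter.Eventually.of_forall fun w => (Real.exp_pos _).le) hφmem hψmem
  -- the product is the integrand
  have hprod : ∫ w, φ w * ψ w ∂μ = ∫ w in (0 : ℝ)..v, ‖S₁ f (Real.exp w)‖ * w := by
    rw [intervalIntegral.integral_of_le hv0.le, hμ]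
    refine integral_congr_ae (Filter.Eventually.of_forall fun w => ?_)
    simp only [hφ, hψ]
    rw [mul_assoc, ← Real.exp_add, show -(α * w) + α * w = 0 by ring, Real.exp_zero, mul_one]
  -- bound the two factors
  have hφ2 : ∫ w, φ w ^ (2:ℝ) ∂μ ≤ J := by
    simp_rw [Real.rpow_two]
    have heq : ∀ w, φ w ^ 2 = w ^ 2 * ‖S₁ f (Real.exp w)‖ ^ 2 * Real.exp (-(2 * α * w)) := by
      intro w
      simp only [hφ]
      rw [mul_pow, mul_pow, ← Real.exp_nat_mul]
      push_cast
      ring_nf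
    simp_rw [heq]
    exact setIntegral_le_integral hJint (Filter.Eventually.of_forall fun u => by positivity)
  have hψ2 : ∫ w, ψ w ^ (2:ℝ) ∂μ ≤ v * Real.exp 4 := by
    simp_rw [Real.rpow_two]
    have hψint : Integrable (fun w => ψ w ^ 2) μ := by
      rw [hμ]; exact (by fun_prop : Continuous fun w => Real.exp (α * w) ^ 2).integrableOn_Ioc
    have hle : ∀ᵐ w ∂μ, ψ w ^ 2 ≤ Real.exp 4 := by
      refine ae_restrict_of_forall_mem measurableSet_Ioc fun w hw => ?_
      simp only [hψ]
      rw [← Real.exp_nat_mul, Real.exp_le_exp]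
      push_cast
      nlinarith [hw.2]
    calc ∫ w, ψ w ^ 2 ∂μ ≤ ∫ w, Real.exp 4 ∂μ := integral_mono_ae hψint (integrable_const _) hle
      _ = v * Real.exp 4 := by
          rw [integral_const, smul_eq_mul]
          simp only [measureReal_def, hμ, Measure.restrict_apply_univ, Real.volume_Ioc, sub_zero,
            ENNReal.toReal_ofReal hv0.le]
  have hφ2_0 : 0 ≤ ∫ w, φ w ^ (2:ℝ) ∂μ := integral_nonneg fun w => by
    show (0 : ℝ) ≤ φ w ^ (2:ℝ); rw [Real.rpow_two]; exact sq_nonneg _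
  have hψ2_0 : 0 ≤ ∫ w, ψ w ^ (2:ℝ) ∂μ := integral_nonneg fun w => by
    show (0 : ℝ) ≤ ψ w ^ (2:ℝ); rw [Real.rpow_two]; exact sq_nonneg _
  rw [← hprod]
  calc ∫ w, φ w * ψ w ∂μ
      ≤ (∫ w, φ w ^ (2:ℝ) ∂μ) ^ (1 / (2:ℝ)) * (∫ w, ψ w ^ (2:ℝ) ∂μ) ^ (1 / (2:ℝ)) := hH
    _ ≤ J ^ (1 / (2:ℝ)) * (v * Real.exp 4) ^ (1 / (2:ℝ)) := by gcongr
    _ = Real.sqrt J * (Real.sqrt v * Real.exp 2) := by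
        rw [← Real.sqrt_eq_rpow, ← Real.sqrt_eq_rpow, Real.sqrt_mul hv0.le,
          show Real.exp 4 = Real.exp 2 ^ 2 by rw [← Real.exp_nat_mul]; norm_num,
          Real.sqrt_sq (Real.exp_pos 2).le]
    _ = Real.exp 2 * Real.sqrt v * Real.sqrt J := by ring

/-! ### §7. The dyadic decomposition: `∫_0^L |S₁(e^w)| dw` -/

/-- The dyadic level: for `L ≥ 1` there is `N` with `L ≤ 2^N ≤ 4L` (`N = ⌈log₂ ⌈L⌉⌉`). [folklore] -/
theorem exists_dyadic_level {L : ℝ} (hL : 1 ≤ L) : ∃ N : ℕ, L ≤ (2 : ℝ) ^ N ∧ (2 : ℝ) ^ N ≤ 4 * L := by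
  set N : ℕ := Nat.clog 2 ⌈L⌉₊ with hN
  have hceil1 : 1 ≤ ⌈L⌉₊ := Nat.one_le_ceil_iff.2 (by linarith)
  refine ⟨N, ?_, ?_⟩
  · have h1 : (⌈L⌉₊ : ℝ) ≤ (2 : ℝ) ^ N := by exact_mod_cast Nat.le_pow_clog one_lt_two ⌈L⌉₊
    exact (Nat.le_ceil L).trans h1
  · rcases Nat.lt_or_ge 1 ⌈L⌉₊ with hc | hc
    · have hNpos : 0 < N := Nat.clog_pos one_lt_two hc
      have h1 : 2 ^ (N - 1) < ⌈L⌉₊ := by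
        have := Nat.pow_pred_clog_lt_self one_lt_two hc
        rwa [Nat.pred_eq_sub_one] at this
      have h2 : ((2 : ℕ) ^ (N - 1) : ℝ) < ⌈L⌉₊ := by exact_mod_cast h1
      have h3 : (⌈L⌉₊ : ℝ) < L + 1 := Nat.ceil_lt_add_one (by linarith)
      have h4 : (2 : ℝ) ^ N = 2 * (2 : ℝ) ^ (N - 1) := by
        rw [← pow_succ']; congr 1; omega
      push_cast at h2
      rw [h4]; linarith
    · have hc1 : ⌈L⌉₊ = 1 := le_antisymm hc hceil1
      have hN0 : N = 0 := by rw [hN, hc1]; simp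
      rw [hN0, pow_zero]; linarith

/-- The geometric sum with ratio `2^κ`, `κ = 4/π − 1`: `Σ_{j<N} (2^j)^κ ≤ 24 L^κ` when `2^N ≤ 4L`,
`L ≥ 1`. [folklore] -/
theorem sum_two_pow_rpow_le {N : ℕ} {L : ℝ} (hL : 1 ≤ L) (h2NL : (2 : ℝ) ^ N ≤ 4 * L) :
    ∑ j ∈ Finset.range N, ((2 : ℝ) ^ j) ^ (4 / π - 1) ≤ 24 * L ^ (4 / π - 1) := by
  obtain ⟨he1, he2⟩ := four_div_pi_bounds
  set κ : ℝ := 4 / π - 1 with hκ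
  have hκ0 : 0 < κ := by rw [hκ]; linarith
  have hκ1 : κ ≤ 1 := by rw [hκ]; linarith
  have h2N0 : (0 : ℝ) < (2 : ℝ) ^ N := by positivity
  set r : ℝ := (2 : ℝ) ^ κ with hr
  have hr1 : 1 + 0.18 ≤ r := by
    have hlog2 : 0.6931471803 < Real.log 2 := Real.log_two_gt_d9
    have hκlow : 0.269 ≤ κ := by
      rw [hκ, le_sub_iff_add_le, le_div_iff₀ Real.pi_pos]; nlinarith [Real.pi_lt_d2]
    have h := Real.add_one_le_exp (Real.log 2 * κ)
    rw [hr, Real.rpow_def_of_pos two_pos]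
    nlinarith
  have hterm : ∀ j : ℕ, ((2 : ℝ) ^ j) ^ κ = r ^ j := fun j => by
    rw [hr, ← Real.rpow_natCast 2 j, ← Real.rpow_mul (by norm_num), mul_comm, Real.rpow_mul (by norm_num),
      Real.rpow_natCast]
  simp_rw [hterm]
  have hgeom : ∑ j ∈ Finset.range N, r ^ j = (r ^ N - 1) / (r - 1) := geom_sum_eq (by linarith) N
  rw [hgeom, div_le_iff₀ (by linarith)]
  have hrN : r ^ N ≤ 4 * L ^ κ := by
    rw [← hterm N]
    calc ((2 : ℝ) ^ N) ^ κ ≤ (4 * L) ^ κ := Real.rpow_le_rpow h2N0.le h2NL hκ0.le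
      _ = (4 : ℝ) ^ κ * L ^ κ := Real.mul_rpow (by norm_num) (by linarith)
      _ ≤ 4 * L ^ κ := by
          refine mul_le_mul_of_nonneg_right ?_ (Real.rpow_nonneg (by linarith) _)
          calc (4 : ℝ) ^ κ ≤ (4 : ℝ) ^ (1 : ℝ) := Real.rpow_le_rpow_of_exponent_le (by norm_num) hκ1
            _ = 4 := Real.rpow_one _
  have hLκ : 1 ≤ L ^ κ := Real.one_le_rpow hL hκ0.le
  nlinarith

/-- **One dyadic block**: if `∫_0^v |S₁(e^w)| w dw ≤ A' R(2/v) v` for `v ≥ 2`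
(`R(α) = δ/α² + δ^{1−4/π}/α + α^{1−4/π}/δ`), then
`∫_{2^j}^{2^{j+1}} |S₁(e^w)| dw ≤ 2A' (δ 4^j + δ^{1−4/π} 2^j + (2^j)^{4/π−1}/δ)`. [folklore] -/
theorem dyadic_block_le (f : ℕ →*₀ ℂ) (hf : ∀ n, ‖f n‖ ≤ 1) {A' δ : ℝ} (hδ : 0 < δ)
    (hG : ∀ v : ℝ, 2 ≤ v → ∫ w in (0 : ℝ)..v, ‖S₁ f (Real.exp w)‖ * w ≤
      A' * (δ / (2 / v) ^ 2 + δ ^ (1 - 4 / π) / (2 / v) + (2 / v) ^ (1 - 4 / π) / δ) * v) (j : ℕ) :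
    ∫ w in (2 : ℝ) ^ j..(2 : ℝ) ^ (j + 1), ‖S₁ f (Real.exp w)‖ ≤
      2 * A' * (δ * (4 : ℝ) ^ j + δ ^ (1 - 4 / π) * (2 : ℝ) ^ j + ((2 : ℝ) ^ j) ^ (4 / π - 1) / δ) := by
  set s : ℝ → ℝ := fun w => ‖S₁ f (Real.exp w)‖ with hs
  have hs0 : ∀ w, 0 ≤ s w := fun w => norm_nonneg _
  have hsle : ∀ w, 0 ≤ w → s w ≤ 1 + w := fun w hw => norm_S₁_exp_le f hf hw
  have hsmeas : Measurable s := (measurable_norm_S₁ f).comp Real.measurable_exp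
  have hsint : ∀ a b : ℝ, 0 ≤ a → a ≤ b → IntervalIntegrable s volume a b := by
    intro a b ha hab
    rw [intervalIntegrable_iff_integrableOn_Icc_of_le hab]
    refine Measure.integrableOn_of_bounded (M := 1 + b) measure_Icc_lt_top.ne hsmeas.aestronglyMeasurable ?_
    refine (ae_restrict_iff' measurableSet_Icc).2 (Filter.Eventually.of_forall fun w hw => ?_)
    rw [Real.norm_eq_abs, abs_of_nonneg (hs0 w)]
    exact (hsle w (ha.trans hw.1)).trans (by linarith [hw.2])
  have hj0 : (0 : ℝ) < (2 : ℝ) ^ j := by positivity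
  have hjj : (2 : ℝ) ^ j ≤ (2 : ℝ) ^ (j + 1) := pow_le_pow_right₀ (by norm_num) (Nat.le_succ j)
  have hv2 : (2 : ℝ) ≤ (2 : ℝ) ^ (j + 1) := by
    calc (2 : ℝ) = 2 ^ 1 := (pow_one _).symm
      _ ≤ 2 ^ (j + 1) := pow_le_pow_right₀ (by norm_num) (by omega)
  have hswint : IntervalIntegrable (fun w => s w * w) volume ((2 : ℝ) ^ j) ((2 : ℝ) ^ (j + 1)) :=
    (hsint _ _ hj0.le hjj).mul_continuousOn continuousOn_id
  have hswint0 : IntervalIntegrable (fun w => s w * w) volume 0 ((2 : ℝ) ^ (j + 1)) :=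
    (hsint 0 _ le_rfl (by positivity)).mul_continuousOn continuousOn_id
  -- `∫ s ≤ 2^{-j} ∫ s w · w ≤ 2^{-j} G(2^{j+1})`
  have h1 : ∫ w in (2 : ℝ) ^ j..(2 : ℝ) ^ (j + 1), s w ≤
      ((2 : ℝ) ^ j)⁻¹ * ∫ w in (2 : ℝ) ^ j..(2 : ℝ) ^ (j + 1), s w * w := by
    rw [← intervalIntegral.integral_const_mul]
    refine intervalIntegral.integral_mono_on hjj (hsint _ _ hj0.le hjj) (hswint.const_mul _) fun w hw => ?_
    calc s w = ((2 : ℝ) ^ j)⁻¹ * (s w * (2 : ℝ) ^ j) := by field_simp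
      _ ≤ ((2 : ℝ) ^ j)⁻¹ * (s w * w) :=
          mul_le_mul_of_nonneg_left (mul_le_mul_of_nonneg_left hw.1 (hs0 w)) (by positivity)
  have h2 : ∫ w in (2 : ℝ) ^ j..(2 : ℝ) ^ (j + 1), s w * w ≤ ∫ w in (0 : ℝ)..(2 : ℝ) ^ (j + 1), s w * w :=
    intervalIntegral.integral_mono_interval hj0.le hjj le_rfl
      (Filter.Eventually.of_forall fun w => by
        show (0 : ℝ) ≤ s w * w
        rcases lt_or_ge w 0 with hw | hw
        · simp only [hs]; rw [S₁_of_lt_one f (Real.exp_lt_one_iff.2 hw), norm_zero, zero_mul]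
        · exact mul_nonneg (hs0 w) hw)
      hswint0
  have h3 := hG ((2 : ℝ) ^ (j + 1)) hv2
  have hαj : (2 : ℝ) / (2 : ℝ) ^ (j + 1) = ((2 : ℝ) ^ j)⁻¹ := by rw [pow_succ]; field_simp
  have hκeq : (1 : ℝ) - 4 / π = -(4 / π - 1) := by ring
  have hRj : δ / ((2 : ℝ) / (2 : ℝ) ^ (j + 1)) ^ 2 + δ ^ (1 - 4 / π) / ((2 : ℝ) / (2 : ℝ) ^ (j + 1)) +
      ((2 : ℝ) / (2 : ℝ) ^ (j + 1)) ^ (1 - 4 / π) / δ =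
        δ * (4 : ℝ) ^ j + δ ^ (1 - 4 / π) * (2 : ℝ) ^ j + ((2 : ℝ) ^ j) ^ (4 / π - 1) / δ := by
    have hp : (((2 : ℝ) ^ j)⁻¹) ^ (1 - 4 / π) = ((2 : ℝ) ^ j) ^ (4 / π - 1) := by
      rw [hκeq, Real.inv_rpow hj0.le, Real.rpow_neg hj0.le, inv_inv]
    rw [hαj, hp, inv_pow, div_inv_eq_mul, div_inv_eq_mul,
      show ((2 : ℝ) ^ j) ^ 2 = (4 : ℝ) ^ j by rw [← pow_mul, mul_comm, pow_mul]; norm_num]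
  rw [hRj] at h3
  calc ∫ w in (2 : ℝ) ^ j..(2 : ℝ) ^ (j + 1), s w
      ≤ ((2 : ℝ) ^ j)⁻¹ * ∫ w in (2 : ℝ) ^ j..(2 : ℝ) ^ (j + 1), s w * w := h1
    _ ≤ ((2 : ℝ) ^ j)⁻¹ * ∫ w in (0 : ℝ)..(2 : ℝ) ^ (j + 1), s w * w :=
        mul_le_mul_of_nonneg_left h2 (by positivity)
    _ ≤ ((2 : ℝ) ^ j)⁻¹ * (A' * (δ * (4 : ℝ) ^ j + δ ^ (1 - 4 / π) * (2 : ℝ) ^ j + ((2 : ℝ) ^ j) ^ (4 / π - 1) / δ) *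
          (2 : ℝ) ^ (j + 1)) := mul_le_mul_of_nonneg_left h3 (by positivity)
    _ = 2 * A' * (δ * (4 : ℝ) ^ j + δ ^ (1 - 4 / π) * (2 : ℝ) ^ j + ((2 : ℝ) ^ j) ^ (4 / π - 1) / δ) := by
        rw [pow_succ]; field_simp

/-- **`∫_0^L |S₁(e^w)| dw ≪ |F(σ)| (δL² + δ^{1−4/π}L + L^{4/π−1}/δ)`** for `L ≥ 1`, `1 < σ ≤ 2`
(Roy–Vatwani (eq:T1 goal) combined with Lemma 7.3; the `α`-integral
`∫_{1/L}^1 M₁(α)dα/α` of the source is replaced by the dyadic sum `Σ_j M(2^{-j})`, and the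
additive constants are absorbed using `|F(σ)| ≫ σ − 1`). The constant is absolute.
[cite: RoyVatwani2019, §6.1 (eq:T1 goal) and §7.2 (Lemma 7.3)] -/
theorem exists_integral_norm_S₁_le :
    ∃ K : ℝ, 0 < K ∧ ∀ f : ℕ →*₀ ℂ, (∀ n, ‖f n‖ ≤ 1) → ∀ σ : ℝ, 1 < σ → σ ≤ 2 →
      ∀ L : ℝ, 1 ≤ L →
        ∫ w in (0 : ℝ)..L, ‖S₁ f (Real.exp w)‖ ≤
          K * ‖LSeries (f ·) σ‖ *
            ((σ - 1) * L ^ 2 + (σ - 1) ^ (1 - 4 / π) * L + L ^ (4 / π - 1) / (σ - 1)) := by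
  obtain ⟨KJ, hKJ, hJ⟩ := exists_meanSquare_le
  obtain ⟨cF, hcF, hFge⟩ := exists_norm_LSeries_ge
  obtain ⟨he1, he2⟩ := four_div_pi_bounds
  set A : ℝ := Real.exp 2 * Real.sqrt (KJ / 2) with hA
  have hA0 : 0 < A := by positivity
  refine ⟨2 * A * 24 + 2 / cF, by positivity, fun f hf σ hσ hσ2 L hL => ?_⟩
  have hδ : 0 < σ - 1 := by linarith
  have hδ1 : σ - 1 ≤ 1 := by linarith
  set δ : ℝ := σ - 1 with hδdef
  have hκ0 : (0 : ℝ) < 4 / π - 1 := by linarith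
  set Fσ : ℝ := ‖LSeries (f ·) σ‖ with hFσ
  have hF0 : 0 ≤ Fσ := norm_nonneg _
  have hFge' : cF * δ ≤ Fσ := hFge f hf σ hσ hσ2
  have hδpow : 0 ≤ δ ^ (1 - 4 / π) := Real.rpow_nonneg hδ.le _
  set s : ℝ → ℝ := fun w => ‖S₁ f (Real.exp w)‖ with hs
  have hs0 : ∀ w, 0 ≤ s w := fun w => norm_nonneg _
  have hsle : ∀ w, 0 ≤ w → s w ≤ 1 + w := fun w hw => norm_S₁_exp_le f hf hw
  have hsmeas : Measurable s := (measurable_norm_S₁ f).comp Real.measurable_exp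
  have hsint : ∀ a b : ℝ, 0 ≤ a → a ≤ b → IntervalIntegrable s volume a b := by
    intro a b ha hab
    rw [intervalIntegrable_iff_integrableOn_Icc_of_le hab]
    refine Measure.integrableOn_of_bounded (M := 1 + b) measure_Icc_lt_top.ne hsmeas.aestronglyMeasurable ?_
    refine (ae_restrict_iff' measurableSet_Icc).2 (Filter.Eventually.of_forall fun w hw => ?_)
    rw [Real.norm_eq_abs, abs_of_nonneg (hs0 w)]
    exact (hsle w (ha.trans hw.1)).trans (by linarith [hw.2])
  -- `G(v) ≤ A Fσ R(2/v) v` for `v ≥ 2`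
  have hG : ∀ v : ℝ, 2 ≤ v → ∫ w in (0 : ℝ)..v, s w * w ≤
      (A * Fσ) * (δ / (2 / v) ^ 2 + δ ^ (1 - 4 / π) / (2 / v) + (2 / v) ^ (1 - 4 / π) / δ) * v := by
    intro v hv
    have hv0 : 0 < v := by linarith
    have hα : 0 < 2 / v := by positivity
    have hα1 : 2 / v ≤ 1 := by rw [div_le_one hv0]; linarith
    set Rv : ℝ := δ / (2 / v) ^ 2 + δ ^ (1 - 4 / π) / (2 / v) + (2 / v) ^ (1 - 4 / π) / δ with hRv
    have hRv0 : 0 ≤ Rv := by positivity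
    have h1 := integral_norm_S₁_mul_le f hf hv
    have hJle : ∫ u : ℝ, u ^ 2 * ‖S₁ f (Real.exp u)‖ ^ 2 * Real.exp (-(2 * (2 / v) * u)) ≤
        KJ * Fσ ^ 2 * Rv ^ 2 / (2 / v) := hJ f hf σ hσ hσ2 (2 / v) hα hα1
    have hsq : Real.sqrt (∫ u : ℝ, u ^ 2 * ‖S₁ f (Real.exp u)‖ ^ 2 * Real.exp (-(2 * (2 / v) * u))) ≤
        Real.sqrt (KJ / 2) * Fσ * Rv * Real.sqrt v := by
      refine (Real.sqrt_le_sqrt hJle).trans (le_of_eq ?_)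
      rw [show KJ * Fσ ^ 2 * Rv ^ 2 / (2 / v) = (KJ / 2) * (Fσ * Rv) ^ 2 * v by field_simp]
      rw [Real.sqrt_mul (by positivity), Real.sqrt_mul (by positivity), Real.sqrt_sq (by positivity)]
      ring
    calc ∫ w in (0 : ℝ)..v, s w * w ≤ Real.exp 2 * Real.sqrt v *
          Real.sqrt (∫ u : ℝ, u ^ 2 * ‖S₁ f (Real.exp u)‖ ^ 2 * Real.exp (-(2 * (2 / v) * u))) := h1
      _ ≤ Real.exp 2 * Real.sqrt v * (Real.sqrt (KJ / 2) * Fσ * Rv * Real.sqrt v) := by gcongr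
      _ = A * Fσ * Rv * (Real.sqrt v * Real.sqrt v) := by rw [hA]; ring
      _ = A * Fσ * Rv * v := by rw [Real.mul_self_sqrt hv0.le]
  have hblock := dyadic_block_le f hf (A' := A * Fσ) hδ hG
  -- the dyadic level
  obtain ⟨N, hL2N, h2NL⟩ := exists_dyadic_level hL
  have h2N0 : (0 : ℝ) < (2 : ℝ) ^ N := by positivity
  -- `∫_0^L s ≤ ∫_0^1 s + Σ_{j<N} ∫_{2^j}^{2^{j+1}} s`
  have hmono : ∫ w in (0 : ℝ)..L, s w ≤ ∫ w in (0 : ℝ)..(2 : ℝ) ^ N, s w :=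
    intervalIntegral.integral_mono_interval le_rfl (by linarith) hL2N
      (Filter.Eventually.of_forall fun w => hs0 w) (hsint 0 _ le_rfl h2N0.le)
  have hsum := intervalIntegral.sum_integral_adjacent_intervals (μ := volume) (f := s)
    (a := fun j : ℕ => (2 : ℝ) ^ j) (n := N)
    (fun j _ => hsint _ _ (by positivity) (pow_le_pow_right₀ (by norm_num) (Nat.le_succ j)))
  simp only [pow_zero] at hsum
  have hadd := intervalIntegral.integral_add_adjacent_intervals (hsint 0 1 le_rfl zero_le_one)
    (hsint 1 ((2 : ℝ) ^ N) zero_le_one (one_le_pow₀ (by norm_num)))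
  -- `∫_0^1 s ≤ 2`
  have hI01 : ∫ w in (0 : ℝ)..1, s w ≤ 2 := by
    have h := intervalIntegral.integral_mono_on zero_le_one (hsint 0 1 le_rfl zero_le_one)
      intervalIntegrable_const (fun w hw => (hsle w hw.1).trans (by linarith [hw.2] : 1 + w ≤ 2))
    simpa using h
  -- the dyadic sums
  have hsum4 : ∑ j ∈ Finset.range N, (4 : ℝ) ^ j ≤ 16 * L ^ 2 / 3 := by
    have hgeom : ∑ j ∈ Finset.range N, (4 : ℝ) ^ j = ((4 : ℝ) ^ N - 1) / (4 - 1) := geom_sum_eq (by norm_num) N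
    have h4N : (4 : ℝ) ^ N = ((2 : ℝ) ^ N) ^ 2 := by rw [← pow_mul, mul_comm, pow_mul]; norm_num
    have hsq : ((2 : ℝ) ^ N) ^ 2 ≤ (4 * L) ^ 2 := pow_le_pow_left₀ h2N0.le h2NL 2
    rw [hgeom, h4N]
    linarith
  have hsum2 : ∑ j ∈ Finset.range N, (2 : ℝ) ^ j ≤ 4 * L := by
    have hgeom : ∑ j ∈ Finset.range N, (2 : ℝ) ^ j = ((2 : ℝ) ^ N - 1) / (2 - 1) := geom_sum_eq (by norm_num) N
    rw [hgeom]; norm_num; linarith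
  have hsumκ := sum_two_pow_rpow_le hL h2NL
  have hblocks : ∑ j ∈ Finset.range N, ∫ w in (2 : ℝ) ^ j..(2 : ℝ) ^ (j + 1), s w ≤
      2 * (A * Fσ) * (δ * (16 * L ^ 2 / 3) + δ ^ (1 - 4 / π) * (4 * L) + 24 * L ^ (4 / π - 1) / δ) := by
    calc ∑ j ∈ Finset.range N, ∫ w in (2 : ℝ) ^ j..(2 : ℝ) ^ (j + 1), s w
        ≤ ∑ j ∈ Finset.range N, 2 * (A * Fσ) *
            (δ * (4 : ℝ) ^ j + δ ^ (1 - 4 / π) * (2 : ℝ) ^ j + ((2 : ℝ) ^ j) ^ (4 / π - 1) / δ) :=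
          Finset.sum_le_sum fun j _ => hblock j
      _ = 2 * (A * Fσ) * (δ * ∑ j ∈ Finset.range N, (4 : ℝ) ^ j +
            δ ^ (1 - 4 / π) * ∑ j ∈ Finset.range N, (2 : ℝ) ^ j +
            (∑ j ∈ Finset.range N, ((2 : ℝ) ^ j) ^ (4 / π - 1)) / δ) := by
          rw [← Finset.mul_sum, Finset.sum_add_distrib, Finset.sum_add_distrib, Finset.mul_sum,
            Finset.mul_sum, Finset.sum_div]
      _ ≤ 2 * (A * Fσ) * (δ * (16 * L ^ 2 / 3) + δ ^ (1 - 4 / π) * (4 * L) + 24 * L ^ (4 / π - 1) / δ) := by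
          gcongr
  -- assemble
  have hLκ1 : 1 ≤ L ^ (4 / π - 1) := Real.one_le_rpow hL hκ0.le
  have hconst : 2 ≤ 2 / cF * Fσ * (L ^ (4 / π - 1) / δ) := by
    have h2 : 1 / δ ≤ L ^ (4 / π - 1) / δ := div_le_div_of_nonneg_right hLκ1 hδ.le
    calc (2 : ℝ) = 2 / cF * (cF * δ) * (1 / δ) := by field_simp
      _ ≤ 2 / cF * Fσ * (L ^ (4 / π - 1) / δ) := by gcongr
  have hmainle : ∫ w in (0 : ℝ)..L, s w ≤
      2 + 2 * (A * Fσ) * (δ * (16 * L ^ 2 / 3) + δ ^ (1 - 4 / π) * (4 * L) + 24 * L ^ (4 / π - 1) / δ) := by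
    linarith [hmono, hsum, hadd, hI01, hblocks]
  set Φ : ℝ := δ * L ^ 2 + δ ^ (1 - 4 / π) * L + L ^ (4 / π - 1) / δ with hΦ
  have hΦ1 : 0 ≤ δ * L ^ 2 := by positivity
  have hΦ2 : 0 ≤ δ ^ (1 - 4 / π) * L := by positivity
  have hΦ3 : 0 ≤ L ^ (4 / π - 1) / δ := by positivity
  have hshape : δ * (16 * L ^ 2 / 3) + δ ^ (1 - 4 / π) * (4 * L) + 24 * L ^ (4 / π - 1) / δ ≤ 24 * Φ := by
    rw [hΦ]
    have hid : 24 * (δ * L ^ 2 + δ ^ (1 - 4 / π) * L + L ^ (4 / π - 1) / δ) -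
        (δ * (16 * L ^ 2 / 3) + δ ^ (1 - 4 / π) * (4 * L) + 24 * L ^ (4 / π - 1) / δ) =
        56 / 3 * (δ * L ^ 2) + 20 * (δ ^ (1 - 4 / π) * L) := by ring
    linarith [hid, hΦ1, hΦ2]
  have hc2 : 2 ≤ 2 / cF * Fσ * Φ := by
    refine hconst.trans (mul_le_mul_of_nonneg_left ?_ (by positivity))
    rw [hΦ]; linarith
  have hAF : 0 ≤ 2 * (A * Fσ) := by positivity
  calc ∫ w in (0 : ℝ)..L, s w
      ≤ 2 + 2 * (A * Fσ) * (δ * (16 * L ^ 2 / 3) + δ ^ (1 - 4 / π) * (4 * L) + 24 * L ^ (4 / π - 1) / δ) :=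
        hmainle
    _ ≤ 2 / cF * Fσ * Φ + 2 * (A * Fσ) * (24 * Φ) := add_le_add hc2 (mul_le_mul_of_nonneg_left hshape hAF)
    _ = (2 * A * 24 + 2 / cF) * Fσ * Φ := by ring

end Literature.NumberTheory.LFunctions.MontgomeryVaughan2001
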